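/-
Copyright: statement-level skeleton of a published paper (lit-balaban cell, Phase-2 proof seat p26 gen 41). No claims beyond
what the kernel checks below.
-/
import Mathlib
import Literature.MathematicalPhysics.QuantumFieldTheory.Balaban1983to89.B3Eq326FromFeynmanRules

/-!
# B3 — T. Bałaban, *(Higgs)₂,₃ quantum fields in a finite volume. III. Renormalization*, CMP **88** (1983) 411–445
[Balaban1983Higgs3] — p. 438 [PDF 28]: **«the graphs with one leg differentiated. There are only two such graphs (3.21)» EVALUATED BY
THE FEYNMAN RULES** — the general evaluator of `B3GraphAmplitude` / `B3GraphAmplitudeRules` RUN on p18's two graphs `g321a` (the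
A′-loop at the vertex (1.8)_{2,0}, both φ′-legs external, the differentiated one included) and `g321b` (two vertices (1.8)_{1,0}, the
A′-line, one φ′-line from the differentiated leg of `x` to the undifferentiated leg of `x′`; external: the undifferentiated leg of `x` and
the DIFFERENTIATED leg of `x′`) in closed form for arbitrary kernels, background and joint external fields — the first pictures of this
lineage with a DIFFERENTIATED EXTERNAL LEG (its index is summed into the covariant derivative of the external field) —; at zero
background with the free kernels the values ARE p18 g8's expressions `expr321a` (× `e²/2`) and `expr321b` (× `e²`) of
`B3Eq322OneLegDifferentiated`, restated on the (Higgs)₂,₃ carrier; and p18's third graph of this kind `g321Y` (NOT drawn in (3.21): the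
φ′-loop through a differentiated leg) is evaluated too and VANISHES at zero background with the free scalar kernel (`tr q = 0`) — the
kernel's account of why print draws two graphs (FILE 7 of the evaluator; FILE 5 = (3.6)₁/(3.9), FILE 6 = (3.25)/(3.26))

statement-level skeleton of published theorems with citation tags; proofs where landed; nothing here is a claim about
the Yang–Mills mass gap

PDF held: `paper:balaban1983-higgs-2-3-quantum-fields-finite-volume` (journal page = PDF page + 410); p. 438 [PDF 28] read by this seat
(text layer `p0028.txt` L23–27, 2026-08-23); the pictures as decided by p18 (`g321a`, `g321b`; ×4 renders cited there), the expressions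
as typed by p18 g8 (`expr321a`, `ker321`, `expr321b` — print displays only the pictures and, after the Taylor step, (3.23)).

CITATION HEADER (lean-in-tree rule).  lit-balaban TYPED SKELETON (HOME `run/shared/lean/pub/lit-balaban/`), PHASE 2, seat p26 gen 41
(unit `lit-balaban-p26`, the evaluator lineage FILEs 1–6: `B3GraphAmplitude` p361338/p366813, `B3GraphAmplitudeRules` p362438,
`B3Eq36TadpoleExpressions` p363523, `B3ExpansionFromFeynmanRules` p363747/p364487, `B3Eq39FromFeynmanRules` p365665,
`B3Eq326FromFeynmanRules` p367199); free-target protocol G.5-34(d) (own lane; announced in HOME/STATUS.md with this file's proposal).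
ROW **B3.Eq3.21-3.24** of `HOME/lit-balaban-r15/ROWS-B3.md` (pp. 438–439; fold owner r15; head `proved` — r15's `B3Sect3ScalarSelfEnergy`
(3.23), p18 g8's `B3Eq322OneLegDifferentiated`/`B3Eq322PositiveDegree` and sequels; this file is an OPTIONAL located member of its (3.21)
cell, zero head weight), also **B3.Def@420** (E(G, ·) run on two more pictures).  CONSUMES BY NAME, nothing re-declared: p18's
`B3Sect3LowestOrderGraphs.{g321a, g321b}`, `B3Eq37Pictures.{kind36, sLeg, vLeg}`; FILE 1's `amp`, leg/line/pairing vocabulary and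
`prodExtV`; FILE 2's `Model`, `Loc`, `rulesOf`, `rule18`, `basisE`, `basisV`, `extS`, `graphAmp`; FILE 3's `basisE_eq`; FILE 5's `dq`, `vterm`,
`pleg18_basisE`, `inner_basisE_left`, `inner_q_q`; FILE 6's `ta`, `tv`, `kindD`, `sd`, `vd`, `tAssign`/`sum_tAssign`/`alpha_sum2`, `bAssign`/
`beta_sum2`, `alpha_sumD`, `beta_sumD`, `vlegs_two_basisV`, `dK1`, `dK1_single`, `sum_dK1_single`, `dK1_zero_free`, `dKernelL`,
`rule18_basis`, `rule18_two_zero_basis`; the typer's `HiggsLattice.{ChargeData, ChargeData.U, covDeriv, covDeriv_zero, Site.shift, PBond}`.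

THE PRINTED TEXT (verbatim, p. 438 [PDF 28]; p18 g8's transcription, checked against the text layer): *"We have to consider another class
of graphs with two external scalar field legs, the graphs with one leg differentiated. There are only two such graphs: [picture a: one
vertex, two scalar legs one of which carries the derivative, a vector-field loop] , [picture b: two vertices x, x′ joined by a scalar line
and a vector line, external scalar legs at x and at x′, the one at x′ differentiated] (3.21) The expression corresponding to the first graph
is in fact convergent, because ηG_k(x,x) is convergent to some finite constant as η → 0. The second expression is transformed in a way
similar to (3.17) and (3.20): … (3.22)"*; p18 g8's typed expressions (`B3Eq322OneLegDifferentiated`): `expr321a η q G g φ φ′ = Σ_μ Σ_x η^d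
(η G(x,x) g(x) φ(x)·q(q(∂^η_μφ′)(x)))`, `expr321b η q G₀ G_j g g′ φ φ′ = Σ_μ Σ_{x,x′} η^{2d} ((∂^η_μG₀)(x,x′)g(x)G_j(x,x′)g′(x′) φ(x)·q(q
(∂^η_μφ′)(x′)))`.  The vertex (1.8) p. 413 (typer's `vertex18`, FILE 2's polarized `rule18`); p. 414 *"each pair is replaced by the
corresponding propagator"*.

READING (declared).  (a) A DIFFERENTIATED EXTERNAL LEG (§2, new in this file): in the index form of FILE 1 the external leg carries the
basis field `δ_p` of its index `p` INSIDE the vertex's covariant derivative; summing `p` against the components of the external field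
reassembles the field under `D^η_B̃` by linearity (`sum_coord_covDeriv_basisE`: `Σ_p φ′(p)[(D^η_B̃δ_p)(b)·u] = (D^η_B̃φ′)(b)·u`, any
background).  (b) THE GENERAL EVALUATIONS (§3, §4) hold for arbitrary model data, localization weights, kernels and joint external fields,
as in FILEs 5–6; for product fields (3.21)₁ is literally the polarized vertex (1.8)_{2,0} with `(g_kA′_b)²` replaced by `g_k(b₋)²·Kv(b,b)`
(`graphAmp_g321a_extS`, any `B̃`).  (c) THE FREE SPECIALIZATION (§5) = print's setting (p. 433 `B̃ = 0`, scale pieces `G ⊗ 1_N` on the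
φ′-line, the direction-diagonal reading `[μ = μ′]G_j(x,x′)` of the A′-line kernel — HYPOTHESES on the supplied kernels —, all bonds, site-
valued localization weights read at `b₋`; the cut-off `g_k` stays: `g = g₀g_k²` in (3.21)₁ (both A′-legs of the one vertex), `g = g₀g_k`,
`g′ = g₁g_k` in (3.21)₂).  (d) WHICH FIELD ON WHICH LEG follows p18's expressions: (3.21)₁ — `φ′` on the differentiated leg, `φ` on the other
(`pairExt1`); (3.21)₂ — `φ` at `x`, `φ′` on the differentiated leg at `x′` (`pairExt2`).  (e) COEFFICIENTS AND SIGNS as the kernel finds them: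
`E((3.21)₁) = (e²/2)·expr321a` (the `1/2!` of (1.8)_{2,0} stays — the A′-loop has one pairing; p18's `expr321a` carries neither `e²` nor `½`),
`E((3.21)₂) = +e²·expr321b` (`(−e)²`; `qφ·q^T(∂φ′) = φ·q²∂φ′` by `inner_qq_symm`); `E(g321Y) = 0` at `B̃ = 0` with `Ks = G₀ ⊗ 1_N`
(§6: the loop factor is `(∂^η_μG₀)(x,x)·Σ_c e_c·qe_c` and `e_c·qe_c = 0`), for ANY vector kernel, weights, bond set and external field —
at a general background the loop does not vanish (the closed form `graphAmp_g321Y` keeps it).  (f) CARRIERS: p18's expressions live on the tree's other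
torus carrier (`Setup.Site`); they are RESTATED here symbol by symbol (`pdiffT`, `expr321aT`, `ker321T`, `expr321bT`; `dKernelL` of FILE 6 =
r15's `d1Kernel`) — «restated», not «identified»; the sub-family bridge `B1Eq211ZeroFieldTorusLevels.eSiteAt` is not invoked.

WHAT IS TYPED / PROVED (definitions with bodies + theorems; no `Prop` fact, no `sorry`; standard axioms).  §1 (3.21)₁: `vx1`, `sother1`,
`vother1`, `vlower1_iff` (decided on `g321a 2 le_rfl`), `vline1`, `uniqueVLine1`, `vmate1`, `instIsEmptySLine1`, `instIsEmptyExtVLeg1`, `es1`,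
`univ_extSLeg1`, `dExt`, **`ext_fun_eq1`**, `extS_dExt`, `pairExt1`; (3.21)₂: `vx2`, **`sother2`**, `vother2`, `slower2_iff`/`vlower2_iff`
(decided on `g321b 1 le_rfl`), `sline2`, `vline2`, `uniqueSLine2`/`uniqueVLine2`, `mate2`, `instIsEmptyExtVLeg2`, `es2`, `es2_cases`,
`univ_extSLeg2`, `bExt`, **`ext_fun_eq2`**, `extS_bExt`, `pairExt2`; §2 `inner_covDeriv_basisE`, **`sum_coord_covDeriv_basisE`**,
(private) `sum_inner_T_single`, `inner_qq_symm`, `sq_apply`, `alpha_sum2'`; §3 `graphAmp_eq1`, **`graphAmp_g321a`** (`E = A(∅)Ψ(∅)·(e²η/2) Σ_{b∈S} w η^d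
g_k² Kv(b,b) Σ_{p,c}[(D^η_B̃δ_p)(b)·q²e_c]Φ(p,(b₋,c))`), **`graphAmp_g321a_extS`** (`… Kv(b,b)·[(D^η_B̃φ′)(b)·q²φ(b₋)]`); §4 `graphAmp_eq2`,
**`graphAmp_g321b`** (`E = A(∅)Ψ(∅)·e² Σ_{b,b′∈S} w₀w₁ η^{2d} g_kg_k Kv(b,b′) Σ_{p′,c,c′} dK1(Ks)(b,qe_c;(b′₋,c′))[(D^η_B̃δ_{p′})(b′)·qe_{c′}]
Φ((b₋,c),p′)`), **`graphAmp_g321b_extS`** (`… Σ_{c′} dK1(Ks)(b,qφ(b₋);(b′₋,c′))[(D^η_B̃φ′)(b′)·qe_{c′}]`); §5 `pdiffT`, `covDeriv_zero_eq_pdiffT`,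
`expr321aT`, `ker321T`, `expr321bT`, **`graphAmp_g321a_free`** (`= A(∅)Ψ(∅)·(e²/2)·expr321aT η q G (g₀g_k²) φ φ′`), **`graphAmp_g321b_free`**
(`= A(∅)Ψ(∅)·e²·expr321bT η q G₀ G_j (g₀g_k) (g₁g_k) φ φ′`); §6 `g321Y`: `vxY`, `sotherY`, `votherY`, `slowerY_iff`/`vlowerY_iff`, `slineY`,
`vlineY`, `mateY`, `esY`, `esY_cases`, `univ_extSLegY`, `yExt`, `ext_fun_eqY`, `extS_yExt`, `inner_q_self` (`u·qu = 0`), `sum_q_single_diag`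
(`tr q = 0`), `graphAmp_eqY`, **`graphAmp_g321Y`** (`E = A(∅)Ψ(∅)·e² Σ_{b,b′∈S} w₀w₁ η^{2d} g_kg_k Kv(b,b′) (Σ_c dK1(Ks)(b,qe_c;(b₋,c)))
Σ_{p′,c′}[(D^η_B̃δ_{p′})(b′)·qe_{c′}]Φ((b′₋,c′),p′)`), **`graphAmp_g321Y_extS`**, **`graphAmp_g321Y_free`** (`= 0` for `B̃ = 0`, `Ks = G₀ ⊗ 1_N`).
HONEST SCOPE.  (a) Identification with p18's (3.21) expressions RESTATED on the (Higgs)₂,₃ carrier (reading (f)); no carrier bridge is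
invoked.  (b) `B̃ = 0`, the free kernels, their direction-diagonal / identity internal structure, all bonds and site-valued weights are
HYPOTHESES of the `free` theorems; §3–§4 hold in general.  (c) (3.22)–(3.24) (the Taylor step, the positive-degree graph, (3.23), the
momentum integral) are p18 g8's / r15's and are not touched; no `RClass` is formed; that print omits `g321Y` BECAUSE of §6 is this
seat's inference (print is silent), recorded as a reading, not as a claim about print.  (d) Nothing analytic.  Unit `lit-balaban-p26` gen 41 (literature-prover-lit-balaban-p26-g41-0; filed by gen 42,
literature-prover-lit-balaban-p26-g42-0), HOME `run/shared/lean/pub/lit-balaban/`, 2026-08-23.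
-/

open Finset
open scoped BigOperators InnerProductSpace

namespace Literature.MathematicalPhysics.QuantumFieldTheory.Balaban1983to89.B3Eq322FromFeynmanRules

open Literature.MathematicalPhysics.QuantumFieldTheory.Balaban1983to89.HiggsLattice (ChargeData covDeriv)
open Literature.MathematicalPhysics.QuantumFieldTheory.Balaban1983to89.B3Prop1 (VertexKind)
open Literature.MathematicalPhysics.QuantumFieldTheory.Balaban1983to89.B3Cor23Concrete (Graph Leg)
open Literature.MathematicalPhysics.QuantumFieldTheory.Balaban1983to89.B3Sect3LowestOrderGraphs (g321a g321b g321Y)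
open Literature.MathematicalPhysics.QuantumFieldTheory.Balaban1983to89.B3Eq37Pictures (kind36 sLeg vLeg)
open Literature.MathematicalPhysics.QuantumFieldTheory.Balaban1983to89.B3GraphAmplitude
open Literature.MathematicalPhysics.QuantumFieldTheory.Balaban1983to89.B3GraphAmplitudeRules
open Literature.MathematicalPhysics.QuantumFieldTheory.Balaban1983to89.B3Eq36TadpoleExpressions (basisE_eq opCoeff pleg110_basisE)
open Literature.MathematicalPhysics.QuantumFieldTheory.Balaban1983to89.B3ExpansionFromFeynmanRules
open Literature.MathematicalPhysics.QuantumFieldTheory.Balaban1983to89.B3Eq39FromFeynmanRules (dKs dq dKs_single sum_dKs_single vterm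
  pleg18_basisE vlegs_one_basisV dKernelT siteBlock inner_basisE_left inner_covDeriv_zero_basisE dKs_zero siteBlock_diag inner_q_q)
open Literature.MathematicalPhysics.QuantumFieldTheory.Balaban1983to89.B3Eq326FromFeynmanRules (ta tv ta_cases tv_cases ta_injective2
  tv_injective kindD sd vd sd_cases vd_cases legsCD_ne tAssign tAssign_apply tEquiv sum_tAssign alpha_sum2 bAssign bAssign_apply beta_sum2
  alpha_sumD beta_sumD vlegs_two_basisV dK1 dK1_single sum_dK1_single dK1_zero_free dKernelL dKernelR dKernelL_of_symm rule18_basis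
  rule18_two_zero_basis)

noncomputable section

variable {nbar : ℕ}

/-! ## §1 The legs and the lines of the two pictures (3.21) in the evaluator's vocabulary -/

section Legs

/-! ### (3.21)₁ (p18's `g321a`): one vertex (1.8)_{2,0}, its two A′-legs joined (the A′-loop), both φ′-legs external — FILE 6's `kindD`
vocabulary `sd`, `vd` -/

variable {hn2 : 2 ≤ nbar}

/-- The vertex of (3.21)₁. [cite: Balaban1983Higgs3, (3.21) p.438] -/
def vx1 (nbar : ℕ) (hn2 : 2 ≤ nbar) : Fin (g321a nbar hn2).nV := ⟨0, Nat.one_pos⟩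

/-- the φ′-legs of (3.21)₁ are external (p18's `g321a.other`). [cite: Balaban1983Higgs3, (3.21) p.438] -/
theorem sother1 (j : Fin 2) : (sPairing (g321a nbar hn2)).other (sd j) = none := by
  show spartner (g321a nbar hn2) (sd j) = none
  refine (spartner_eq_none_iff _ _).2 ?_
  fin_cases j <;> rfl

/-- **The A′-loop of (3.21)₁**: the partner of `vd j` is `vd (1−j)`. [cite: Balaban1983Higgs3, (3.21) p.438] -/
theorem vother1 (j : Fin 2) : (vPairing (g321a nbar hn2)).other (vd j) = some (vd j.rev) := by
  show vpartner (g321a nbar hn2) (vd j) = some (vd j.rev)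
  refine (vpartner_eq_some_iff _ _ _).2 ?_
  fin_cases j <;> rfl

/-- `vd 0` is the lower endpoint of the A′-loop and the only one. [cite: Balaban1983Higgs3, (3.21) p.438] -/
theorem vlower1_iff : ∀ ℓ : VLeg (g321a nbar hn2).kind, (vPairing (g321a nbar hn2)).isLower vRank ℓ = true ↔ ℓ = vd 0 := by
  show ∀ ℓ : VLeg (g321a 2 le_rfl).kind, (vPairing (g321a 2 le_rfl)).isLower vRank ℓ = true ↔ ℓ = vd 0
  decide

/-- The A′-loop of (3.21)₁ as a line. [cite: Balaban1983Higgs3, (3.21) p.438] -/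
def vline1 (nbar : ℕ) (hn2 : 2 ≤ nbar) : VLine (g321a nbar hn2) := ⟨vd 0, (vlower1_iff _).2 rfl⟩

/-- the A′-loop is the only vector line of (3.21)₁. [cite: Balaban1983Higgs3, (3.21) p.438] -/
instance uniqueVLine1 : Unique (VLine (g321a nbar hn2)) where
  default := vline1 nbar hn2
  uniq := fun l => Subtype.ext ((vlower1_iff l.1).1 l.2)

/-- the mate of `vd 0` is `vd 1`. [cite: Balaban1983Higgs3, (3.21) p.438] -/
theorem vmate1 : (vPairing (g321a nbar hn2)).mate (vd 0) = vd 1 := (vPairing (g321a nbar hn2)).mate_eq (vother1 0)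

/-- (3.21)₁ has no scalar line. [cite: Balaban1983Higgs3, (3.21) p.438] -/
instance instIsEmptySLine1 : IsEmpty (SLine (g321a nbar hn2)) :=
  ⟨fun l => by
    have h := l.2
    rcases sd_cases l.1 with e | e <;> rw [e, (sPairing (g321a nbar hn2)).not_isLower_of_none sRank (sother1 _)] at h <;>
      exact Bool.false_ne_true h⟩

/-- (3.21)₁ has no external A′-leg. [cite: Balaban1983Higgs3, (3.21) p.438] -/
instance instIsEmptyExtVLeg1 : IsEmpty (ExtVLeg (g321a nbar hn2)) :=
  ⟨fun l => by
    have h := l.2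
    rcases vd_cases l.1 with e | e <;> rw [e, vother1] at h <;> cases h⟩

/-- no averaging output. [cite: Balaban1983Higgs3, (3.21) p.438] -/
instance instIsEmptyOLeg1 : IsEmpty (OLeg (g321a nbar hn2).kind) := ⟨fun ℓ => Fin.elim0 (ℓ.2 : Fin 0)⟩

/-- The external φ′-leg `j` of (3.21)₁ (`j = 0`: the DIFFERENTIATED leg `(D^η_B̃φ′)(b)`, `j = 1`: the leg `·q²φ(b₋)`).
[cite: Balaban1983Higgs3, (3.21) p.438] -/
def es1 (nbar : ℕ) (hn2 : 2 ≤ nbar) (j : Fin 2) : ExtSLeg (g321a nbar hn2) := ⟨sd j, sother1 j⟩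

/-- `es1 0 ≠ es1 1`. [cite: Balaban1983Higgs3, (3.21) p.438] -/
theorem es1_ne : es1 nbar hn2 0 ≠ es1 nbar hn2 1 := fun h => absurd (congrArg Subtype.val h).symm legsCD_ne.2.2.1

/-- the external φ′-legs of (3.21)₁ are exactly `es1 0`, `es1 1`. [cite: Balaban1983Higgs3, (3.21) p.438] -/
theorem univ_extSLeg1 : (univ : Finset (ExtSLeg (g321a nbar hn2))) = {es1 nbar hn2 0, es1 nbar hn2 1} := by
  ext l
  simp only [Finset.mem_univ, Finset.mem_insert, Finset.mem_singleton, true_iff]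
  rcases sd_cases l.1 with h | h
  · left; exact Subtype.ext h
  · right; exact Subtype.ext h

/-- The external-leg assignment of (3.21)₁ with `es1 0` at `p` and `es1 1` at `r`. [cite: Balaban1983Higgs3, (3.21) p.438] -/
def dExt {X : Type*} (p r : X) : ExtSLeg (g321a nbar hn2) → X := fun ℓ => if ℓ = es1 nbar hn2 0 then p else r

/-- values of `dExt`. [cite: Balaban1983Higgs3, (3.21) p.438] -/
theorem dExt_apply {X : Type*} (p r : X) : dExt (hn2 := hn2) p r (es1 nbar hn2 0) = p ∧ dExt (hn2 := hn2) p r (es1 nbar hn2 1) = r := by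
  simp [dExt, (es1_ne (hn2 := hn2)).symm]

/-- every φ′-leg of (3.21)₁ is external: the restriction of an assignment is `dExt` of its two values. [cite: Balaban1983Higgs3, (3.21) p.438] -/
theorem ext_fun_eq1 {X : Type*} (α : SLeg kindD → X) :
    (fun ℓ : ExtSLeg (g321a nbar hn2) => α ℓ.1) = dExt (α (sd 0)) (α (sd 1)) := by
  funext ℓ
  obtain ⟨e0, e1⟩ := dExt_apply (hn2 := hn2) (α (sd 0)) (α (sd 1))
  rcases sd_cases ℓ.1 with h | h
  · have : ℓ = es1 nbar hn2 0 := Subtype.ext h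
    subst this; exact e0.symm
  · have : ℓ = es1 nbar hn2 1 := Subtype.ext h
    subst this; exact e1.symm

/-- A product external field read at `dExt p r`. [cite: Balaban1983Higgs3, p.419] -/
theorem extS_dExt {P : HiggsLattice.Params} {N : ℕ} (φs : ExtSLeg (g321a nbar hn2) → HiggsLattice.ScalarField P 0 N)
    (p r : HiggsLattice.Site P 0 × Fin N) :
    extS (g321a nbar hn2) φs (dExt p r) = φs (es1 nbar hn2 0) p.1 p.2 * φs (es1 nbar hn2 1) r.1 r.2 := by
  unfold extS
  obtain ⟨e0, e1⟩ := dExt_apply (hn2 := hn2) p r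
  rw [show (∏ ℓ : ExtSLeg (g321a nbar hn2), φs ℓ (dExt p r ℓ).1 (dExt p r ℓ).2) =
      ∏ ℓ ∈ ({es1 nbar hn2 0, es1 nbar hn2 1} : Finset _), φs ℓ (dExt p r ℓ).1 (dExt p r ℓ).2 by rw [← univ_extSLeg1],
    Finset.prod_pair es1_ne, e0, e1]

/-- The PRODUCT external field of (3.21)₁ with `φ′` in the DIFFERENTIATED leg and `φ` in the other leg (p18's reading `expr321a`:
`φ(x)·q(q(∂^η_μφ′)(x))`). [cite: Balaban1983Higgs3, (3.21) p.438] -/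
def pairExt1 {P : HiggsLattice.Params} {N : ℕ} (φ φ' : HiggsLattice.ScalarField P 0 N) :
    ExtSLeg (g321a nbar hn2) → HiggsLattice.ScalarField P 0 N :=
  fun ℓ => if ℓ = es1 nbar hn2 0 then φ' else φ

/-- values of `pairExt1`. [cite: Balaban1983Higgs3, (3.21) p.438] -/
theorem pairExt1_apply {P : HiggsLattice.Params} {N : ℕ} (φ φ' : HiggsLattice.ScalarField P 0 N) :
    pairExt1 (hn2 := hn2) φ φ' (es1 nbar hn2 0) = φ' ∧ pairExt1 (hn2 := hn2) φ φ' (es1 nbar hn2 1) = φ := by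
  simp [pairExt1, (es1_ne (hn2 := hn2)).symm]

/-! ### (3.21)₂ (p18's `g321b`): two vertices (1.8)_{1,0}, the A′-line, ONE φ′-line from the differentiated leg of `x` to the
undifferentiated leg of `x′`; external: the undifferentiated leg of `x` and the DIFFERENTIATED leg of `x′` — FILE 6's `kind36` vocabulary -/

variable {hn : 1 ≤ nbar}

/-- The vertex `i` of (3.21)₂ (`i = 0`: `x`, `i = 1`: `x′`). [cite: Balaban1983Higgs3, (3.21) p.438] -/
def vx2 (nbar : ℕ) (hn : 1 ≤ nbar) (i : Fin 2) : Fin (g321b nbar hn).nV := i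

/-- **The φ′-line of (3.21)₂** joins the differentiated leg of `x` to the undifferentiated leg of `x′`; the other two φ′-legs are
external (p18's `g321b.other`). [cite: Balaban1983Higgs3, (3.21) p.438] -/
theorem sother2 :
    (sPairing (g321b nbar hn)).other (ta 0 0) = some (ta 1 1) ∧ (sPairing (g321b nbar hn)).other (ta 1 1) = some (ta 0 0) ∧
      (sPairing (g321b nbar hn)).other (ta 0 1) = none ∧ (sPairing (g321b nbar hn)).other (ta 1 0) = none := by
  refine ⟨?_, ?_, ?_, ?_⟩
  · show spartner (g321b nbar hn) (ta 0 0) = some (ta 1 1)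
    exact (spartner_eq_some_iff _ _ _).2 rfl
  · show spartner (g321b nbar hn) (ta 1 1) = some (ta 0 0)
    exact (spartner_eq_some_iff _ _ _).2 rfl
  · show spartner (g321b nbar hn) (ta 0 1) = none
    exact (spartner_eq_none_iff _ _).2 rfl
  · show spartner (g321b nbar hn) (ta 1 0) = none
    exact (spartner_eq_none_iff _ _).2 rfl

/-- **The A′-line of (3.21)₂** joins the two A′-legs. [cite: Balaban1983Higgs3, (3.21) p.438] -/
theorem vother2 (i : Fin 2) : (vPairing (g321b nbar hn)).other (tv i) = some (tv i.rev) := by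
  show vpartner (g321b nbar hn) (tv i) = some (tv i.rev)
  refine (vpartner_eq_some_iff _ _ _).2 ?_
  fin_cases i <;> rfl

/-- `ta 0 0` is the only lower endpoint among the φ′-legs of (3.21)₂. [cite: Balaban1983Higgs3, (3.21) p.438] -/
theorem slower2_iff : ∀ ℓ : SLeg (g321b nbar hn).kind, (sPairing (g321b nbar hn)).isLower sRank ℓ = true ↔ ℓ = ta 0 0 := by
  show ∀ ℓ : SLeg (g321b 1 le_rfl).kind, (sPairing (g321b 1 le_rfl)).isLower sRank ℓ = true ↔ ℓ = ta 0 0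
  decide

/-- `tv 0` is the only lower endpoint among the A′-legs of (3.21)₂. [cite: Balaban1983Higgs3, (3.21) p.438] -/
theorem vlower2_iff : ∀ ℓ : VLeg (g321b nbar hn).kind, (vPairing (g321b nbar hn)).isLower vRank ℓ = true ↔ ℓ = tv 0 := by
  show ∀ ℓ : VLeg (g321b 1 le_rfl).kind, (vPairing (g321b 1 le_rfl)).isLower vRank ℓ = true ↔ ℓ = tv 0
  decide

/-- The φ′-line of (3.21)₂ (lower endpoint `ta 0 0`, mate `ta 1 1`). [cite: Balaban1983Higgs3, (3.21) p.438] -/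
def sline2 (nbar : ℕ) (hn : 1 ≤ nbar) : SLine (g321b nbar hn) := ⟨ta 0 0, (slower2_iff _).2 rfl⟩

/-- The A′-line of (3.21)₂ (lower endpoint `tv 0`, mate `tv 1`). [cite: Balaban1983Higgs3, (3.21) p.438] -/
def vline2 (nbar : ℕ) (hn : 1 ≤ nbar) : VLine (g321b nbar hn) := ⟨tv 0, (vlower2_iff _).2 rfl⟩

/-- one φ′-line. [cite: Balaban1983Higgs3, (3.21) p.438] -/
instance uniqueSLine2 : Unique (SLine (g321b nbar hn)) where
  default := sline2 nbar hn
  uniq := fun l => Subtype.ext ((slower2_iff l.1).1 l.2)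

/-- one A′-line. [cite: Balaban1983Higgs3, (3.21) p.438] -/
instance uniqueVLine2 : Unique (VLine (g321b nbar hn)) where
  default := vline2 nbar hn
  uniq := fun l => Subtype.ext ((vlower2_iff l.1).1 l.2)

/-- the mates: `ta 0 0 ↦ ta 1 1`, `tv 0 ↦ tv 1`. [cite: Balaban1983Higgs3, (3.21) p.438] -/
theorem mate2 : (sPairing (g321b nbar hn)).mate (ta 0 0) = ta 1 1 ∧ (vPairing (g321b nbar hn)).mate (tv 0) = tv 1 :=
  ⟨(sPairing (g321b nbar hn)).mate_eq sother2.1, (vPairing (g321b nbar hn)).mate_eq (vother2 0)⟩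

/-- (3.21)₂ has no external A′-leg. [cite: Balaban1983Higgs3, (3.21) p.438] -/
instance instIsEmptyExtVLeg2 : IsEmpty (ExtVLeg (g321b nbar hn)) :=
  ⟨fun l => by
    have h := l.2
    rcases tv_cases l.1 with e | e <;> rw [e, vother2] at h <;> cases h⟩

/-- no averaging output. [cite: Balaban1983Higgs3, (3.21) p.438] -/
instance instIsEmptyOLeg2 : IsEmpty (OLeg (g321b nbar hn).kind) := ⟨fun ℓ => Fin.elim0 (ℓ.2 : Fin 0)⟩

/-- The external φ′-legs of (3.21)₂: `es2 0` = the undifferentiated leg of `x` (`ta 0 1`), `es2 1` = the DIFFERENTIATED leg of `x′`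
(`ta 1 0`). [cite: Balaban1983Higgs3, (3.21) p.438] -/
def es2 (nbar : ℕ) (hn : 1 ≤ nbar) : Fin 2 → ExtSLeg (g321b nbar hn)
  | ⟨0, _⟩ => ⟨ta 0 1, sother2.2.2.1⟩
  | ⟨1, _⟩ => ⟨ta 1 0, sother2.2.2.2⟩

/-- `es2 0 ≠ es2 1`. [cite: Balaban1983Higgs3, (3.21) p.438] -/
theorem es2_ne : es2 nbar hn 0 ≠ es2 nbar hn 1 := by
  intro h
  have h' : ta 0 1 = ta 1 0 := congrArg Subtype.val h
  exact absurd (ta_injective2 _ _ _ _ h').1 (by decide)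

/-- every external φ′-leg of (3.21)₂ is `es2 0` or `es2 1`. [cite: Balaban1983Higgs3, (3.21) p.438] -/
theorem es2_cases (ℓ : ExtSLeg (g321b nbar hn)) : ℓ = es2 nbar hn 0 ∨ ℓ = es2 nbar hn 1 := by
  have h := ℓ.2
  rcases ta_cases ℓ.1 with e | e | e | e
  · rw [e, sother2.1] at h; cases h
  · right; exact Subtype.ext e
  · left; exact Subtype.ext e
  · rw [e, sother2.2.1] at h; cases h

/-- the external φ′-legs of (3.21)₂ are exactly `es2 0`, `es2 1`. [cite: Balaban1983Higgs3, (3.21) p.438] -/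
theorem univ_extSLeg2 : (univ : Finset (ExtSLeg (g321b nbar hn))) = {es2 nbar hn 0, es2 nbar hn 1} := by
  ext l
  simp only [Finset.mem_univ, Finset.mem_insert, Finset.mem_singleton, true_iff]
  exact es2_cases l

/-- The external-leg assignment of (3.21)₂ with `es2 0` (the leg at `x`) at `r` and `es2 1` (the differentiated leg at `x′`) at `p′`.
[cite: Balaban1983Higgs3, (3.21) p.438] -/
def bExt {X : Type*} (r p' : X) : ExtSLeg (g321b nbar hn) → X := fun ℓ => if ℓ = es2 nbar hn 0 then r else p'

/-- values of `bExt`. [cite: Balaban1983Higgs3, (3.21) p.438] -/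
theorem bExt_apply {X : Type*} (r p' : X) : bExt (hn := hn) r p' (es2 nbar hn 0) = r ∧ bExt (hn := hn) r p' (es2 nbar hn 1) = p' := by
  simp [bExt, (es2_ne (hn := hn)).symm]

/-- the restriction of an assignment to the external legs of (3.21)₂ is `bExt` of its values at `ta 0 1`, `ta 1 0`.
[cite: Balaban1983Higgs3, (3.21) p.438] -/
theorem ext_fun_eq2 {X : Type*} (α : SLeg kind36 → X) :
    (fun ℓ : ExtSLeg (g321b nbar hn) => α ℓ.1) = bExt (α (ta 0 1)) (α (ta 1 0)) := by
  funext ℓ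
  obtain ⟨e0, e1⟩ := bExt_apply (hn := hn) (α (ta 0 1)) (α (ta 1 0))
  rcases es2_cases ℓ with h | h <;> rw [h]
  · exact e0.symm
  · exact e1.symm

/-- A product external field read at `bExt r p′`. [cite: Balaban1983Higgs3, p.419] -/
theorem extS_bExt {P : HiggsLattice.Params} {N : ℕ} (φs : ExtSLeg (g321b nbar hn) → HiggsLattice.ScalarField P 0 N)
    (r p' : HiggsLattice.Site P 0 × Fin N) :
    extS (g321b nbar hn) φs (bExt r p') = φs (es2 nbar hn 0) r.1 r.2 * φs (es2 nbar hn 1) p'.1 p'.2 := by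
  unfold extS
  obtain ⟨e0, e1⟩ := bExt_apply (hn := hn) r p'
  rw [show (∏ ℓ : ExtSLeg (g321b nbar hn), φs ℓ (bExt r p' ℓ).1 (bExt r p' ℓ).2) =
      ∏ ℓ ∈ ({es2 nbar hn 0, es2 nbar hn 1} : Finset _), φs ℓ (bExt r p' ℓ).1 (bExt r p' ℓ).2 by rw [← univ_extSLeg2],
    Finset.prod_pair es2_ne, e0, e1]

/-- The PRODUCT external field of (3.21)₂ with `φ` in the leg at `x` and `φ′` in the differentiated leg at `x′` (p18's `expr321b`:
`φ(x)·q(q(∂^η_μφ′)(x′))`). [cite: Balaban1983Higgs3, (3.21) p.438] -/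
def pairExt2 {P : HiggsLattice.Params} {N : ℕ} (φ φ' : HiggsLattice.ScalarField P 0 N) :
    ExtSLeg (g321b nbar hn) → HiggsLattice.ScalarField P 0 N :=
  fun ℓ => if ℓ = es2 nbar hn 0 then φ else φ'

/-- values of `pairExt2`. [cite: Balaban1983Higgs3, (3.21) p.438] -/
theorem pairExt2_apply {P : HiggsLattice.Params} {N : ℕ} (φ φ' : HiggsLattice.ScalarField P 0 N) :
    pairExt2 (hn := hn) φ φ' (es2 nbar hn 0) = φ ∧ pairExt2 (hn := hn) φ φ' (es2 nbar hn 1) = φ' := by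
  simp [pairExt2, (es2_ne (hn := hn)).symm]

end Legs

/-! ## §2 A DIFFERENTIATED EXTERNAL leg: summing its index against a product field differentiates the field -/

section ExtDiff

variable {P : HiggsLattice.Params} {N : ℕ}

/-- kernel: the real inner product of `W = ℝ^N` in coordinates. [folklore] -/
private theorem real_inner_eq_sum (v w : HiggsCovariance.E N) : ⟪v, w⟫_ℝ = ∑ a : Fin N, v a * w a := by
  rw [PiLp.inner_apply]
  exact Finset.sum_congr rfl fun a _ => by simp [mul_comm]

/-- kernel: a vector of `W` is the sum of its components times the basis vectors. [folklore] -/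
private theorem sum_smul_single' (u : HiggsCovariance.E N) : ∑ a : Fin N, u a • EuclideanSpace.single a (1 : ℝ) = u := by
  ext i
  simp [Finset.sum_apply, Pi.single_apply]

/-- The covariant derivative of a basis field against a vector, in coordinates: `(D^η_B̃ δ_p)(b)·u = η⁻¹([b₊ = p.1]·(U(B̃_b)^*u)_{p.2} −
[b₋ = p.1]·u_{p.2})`. [cite: Balaban1982Higgs1, (1.7) p.605] -/
theorem inner_covDeriv_basisE (C : ChargeData N) (B : HiggsLattice.VecField P 0) (p : HiggsLattice.Site P 0 × Fin N)
    (b : HiggsLattice.PBond P 0) (u : HiggsCovariance.E N) :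
    ⟪covDeriv C B (basisE p) b, u⟫_ℝ = (P.mesh 0)⁻¹ *
      ((if b.tgt = p.1 then (ContinuousLinearMap.adjoint (C.U (P.mesh 0) (B b)) u) p.2 else 0) - (if b.src = p.1 then u p.2 else 0)) := by
  unfold HiggsLattice.covDeriv
  rw [real_inner_smul_left, inner_sub_left, ← ContinuousLinearMap.adjoint_inner_right, inner_basisE_left, inner_basisE_left]

/-- **A differentiated leg carrying an EXTERNAL field**: summing the index `p` of the leg against the components of `φ′` gives the
covariant derivative of `φ′` — `Σ_p φ′(p)·[(D^η_B̃ δ_p)(b)·u] = (D^η_B̃ φ′)(b)·u` (linearity of `D^η_B̃` in the field).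
[cite: Balaban1983Higgs3, (3.21) p.438] [cite: Balaban1982Higgs1, (1.7) p.605] -/
theorem sum_coord_covDeriv_basisE (C : ChargeData N) (B : HiggsLattice.VecField P 0) (φ' : HiggsLattice.ScalarField P 0 N)
    (b : HiggsLattice.PBond P 0) (u : HiggsCovariance.E N) :
    ∑ p : HiggsLattice.Site P 0 × Fin N, φ' p.1 p.2 * ⟪covDeriv C B (basisE p) b, u⟫_ℝ = ⟪covDeriv C B φ' b, u⟫_ℝ := by
  simp only [inner_covDeriv_basisE, Fintype.sum_prod_type]
  have h1 : ∀ (y : HiggsLattice.Site P 0) (a : Fin N), φ' y a * ((P.mesh 0)⁻¹ *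
      ((if b.tgt = y then (ContinuousLinearMap.adjoint (C.U (P.mesh 0) (B b)) u) a else 0) - (if b.src = y then u a else 0))) =
      (P.mesh 0)⁻¹ * ((if b.tgt = y then φ' y a * (ContinuousLinearMap.adjoint (C.U (P.mesh 0) (B b)) u) a else 0) -
        (if b.src = y then φ' y a * u a else 0)) := by
    intro y a
    by_cases ht : b.tgt = y <;> by_cases hs : b.src = y <;> simp [ht, hs] <;> ring
  simp only [h1, ← Finset.mul_sum, Finset.sum_sub_distrib, Finset.sum_ite_irrel, Finset.sum_const_zero, Finset.sum_ite_eq,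
    Finset.mem_univ, if_true]
  unfold HiggsLattice.covDeriv
  rw [real_inner_smul_left, inner_sub_left, ← ContinuousLinearMap.adjoint_inner_right, real_inner_eq_sum, real_inner_eq_sum]

/-- Contracting the components of a vector against `v·T e_c` reassembles `T`: `Σ_c (v·T e_c)·u_c = v·T u`. [folklore] -/
private theorem sum_inner_T_single (T : HiggsCovariance.E N →L[ℝ] HiggsCovariance.E N) (v u : HiggsCovariance.E N) :
    ∑ c : Fin N, ⟪v, T (EuclideanSpace.single c (1 : ℝ))⟫_ℝ * u c = ⟪v, T u⟫_ℝ := by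
  conv_rhs => rw [← sum_smul_single' u, map_sum, inner_sum]
  refine Finset.sum_congr rfl fun c _ => ?_
  rw [map_smul, real_inner_smul_right, mul_comm]

/-- `q²` is symmetric: `u·q(qv) = v·q(qu)` (`q` antisymmetric). [cite: Balaban1982Higgs1, (1.7) p.605] -/
theorem inner_qq_symm (C : ChargeData N) (u v : HiggsCovariance.E N) : ⟪u, C.q (C.q v)⟫_ℝ = ⟪v, C.q (C.q u)⟫_ℝ := by
  rw [← neg_eq_iff_eq_neg.mpr (inner_q_q C u v), ← neg_eq_iff_eq_neg.mpr (inner_q_q C v u), real_inner_comm]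

/-- the operator square of (1.8)_{2,0} applied: `q^2 v = q(qv)`. [cite: Balaban1983Higgs3, (1.8) p.413] -/
theorem sq_apply (C : ChargeData N) (v : HiggsCovariance.E N) : (C.q ^ 2) v = C.q (C.q v) := by
  rw [sq]
  rfl

end ExtDiff

/-! ### The φ′-leg assignments of (3.21)₂: one site delta (the external leg at `x`), the differentiated external leg free -/

section Assignments

variable {N : ℕ}

/-- kernel: a site delta on the first component of an index `(x, c)` leaves the sum over the internal index. [folklore] -/
private theorem sum_delta_fst {S : Type*} [Fintype S] [DecidableEq S] {N : ℕ} (x : S) (G : S × Fin N → ℝ) :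
    ∑ r : S × Fin N, (if x = r.1 then (1 : ℝ) else 0) * G r = ∑ c : Fin N, G (x, c) := by
  simp only [Fintype.sum_prod_type]
  rw [Finset.sum_eq_single x]
  · simp only [if_true, one_mul]
  · intro a _ ha
    simp only [if_neg (fun h : x = a => ha h.symm), zero_mul, Finset.sum_const_zero]
  · intro h
    exact absurd (Finset.mem_univ x) h

/-- **The sum over the φ′-leg assignments of (3.21)₂**: the site delta of the undifferentiated external leg of `x` (at `x`), the
site delta of the undifferentiated internal leg of `x′` (at `x′`); the differentiated legs — the internal one of `x` (index `p`) and
the EXTERNAL one of `x′` (index `p′`) — run over all indices: FILE 6's `alpha_sum2` serves verbatim. [cite: Balaban1983Higgs3, (3.21) p.438] -/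
theorem alpha_sum2' {S : Type*} [Fintype S] [DecidableEq S] (x x' : S) (F : S × Fin N → S × Fin N → S × Fin N → S × Fin N → ℝ) :
    ∑ α : SLeg kind36 → S × Fin N, (if x = (α (ta 0 1)).1 then (1 : ℝ) else 0) *
        ((if x' = (α (ta 1 1)).1 then (1 : ℝ) else 0) * F (α (ta 0 0)) (α (ta 1 0)) (α (ta 0 1)) (α (ta 1 1))) =
      ∑ p : S × Fin N, ∑ p' : S × Fin N, ∑ c : Fin N, ∑ c' : Fin N, F p p' (x, c) (x', c') :=
  alpha_sum2 x x' F

end Assignments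

/-! ## §3 The evaluator on (3.21)₁: the closed form -/

section EvalA

variable {P : HiggsLattice.Params} {N k : ℕ} {hn2 : 2 ≤ nbar}
variable [DecidableEq (HiggsLattice.PBond P 0)]

/-- The evaluator on (3.21)₁ with `kindD`-typed index assignments — FILE 1's `amp` unfolded. [cite: Balaban1983Higgs3, p.420] -/
theorem graphAmp_eq1 (M : Model P N k) (dm2 : Fin (g321a nbar hn2).nV → HiggsLattice.Site P 0 → ℝ)
    (loc : Fin (g321a nbar hn2).nV → Loc P k) (Po : OutPairing (g321a nbar hn2))
    (Ks : SLine (g321a nbar hn2) → HiggsLattice.Site P 0 × Fin N → HiggsLattice.Site P 0 × Fin N → ℝ)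
    (Kv : VLine (g321a nbar hn2) → HiggsLattice.PBond P 0 → HiggsLattice.PBond P 0 → ℝ)
    (Ko : Po.Line oRank → HiggsLattice.Site P k × Fin N → HiggsLattice.Site P k × Fin N → ℝ)
    (Φ : (ExtSLeg (g321a nbar hn2) → HiggsLattice.Site P 0 × Fin N) → ℝ) (A : (ExtVLeg (g321a nbar hn2) → HiggsLattice.PBond P 0) → ℝ)
    (Ψ : (Po.Ext → HiggsLattice.Site P k × Fin N) → ℝ) :
    graphAmp (g321a nbar hn2) M dm2 loc Po Ks Kv Ko Φ A Ψ =
      ∑ α : SLeg kindD → HiggsLattice.Site P 0 × Fin N, ∑ β : VLeg kindD → HiggsLattice.PBond P 0,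
        ∑ ο : OLeg kindD → HiggsLattice.Site P k × Fin N,
          vertexFactor (rulesOf (g321a nbar hn2) M dm2 loc) basisE basisV basisE α β ο *
            (Φ (fun ℓ => α ℓ.1) * A (fun ℓ => β ℓ.1) * Ψ (fun ℓ => ο ℓ.1)) *
            (sLineFactor Ks α * vLineFactor Kv β * oLineFactor Po Ko ο) := rfl

/-- **The evaluator EVALUATED on the picture (3.21)₁** (the vertex (1.8)_{2,0} `(e²η/2!)Σ_b η^d[(D^η_B̃φ′)(b)·q²φ′(b₋)](g_kA′_b)²` with
its two A′-legs joined — *"each pair is replaced by the corresponding propagator"*, here `Kv(b,b)` — and both φ′-legs external): for ANY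
joint external field `Φ`,
`E = A(∅)Ψ(∅) · (e²η/2) Σ_{b∈S} w(b) η^d g_k(b₋)² Kv(b,b) Σ_{p,c} [(D^η_B̃ δ_p)(b)·q²e_c] Φ(p, (b₋,c))`
(the differentiated external leg keeps its free index `p`). [cite: Balaban1983Higgs3, (3.21) p.438] [cite: Balaban1983Higgs3, (1.8) p.413]
[cite: Balaban1983Higgs3, p.414] -/
theorem graphAmp_g321a (M : Model P N k) (dm2 : Fin (g321a nbar hn2).nV → HiggsLattice.Site P 0 → ℝ)
    (loc : Fin (g321a nbar hn2).nV → Loc P k) (Po : OutPairing (g321a nbar hn2))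
    (Ks : SLine (g321a nbar hn2) → HiggsLattice.Site P 0 × Fin N → HiggsLattice.Site P 0 × Fin N → ℝ)
    (Kv : VLine (g321a nbar hn2) → HiggsLattice.PBond P 0 → HiggsLattice.PBond P 0 → ℝ)
    (Ko : Po.Line oRank → HiggsLattice.Site P k × Fin N → HiggsLattice.Site P k × Fin N → ℝ)
    (Φ : (ExtSLeg (g321a nbar hn2) → HiggsLattice.Site P 0 × Fin N) → ℝ) (A : (ExtVLeg (g321a nbar hn2) → HiggsLattice.PBond P 0) → ℝ)
    (Ψ : (Po.Ext → HiggsLattice.Site P k × Fin N) → ℝ) :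
    graphAmp (g321a nbar hn2) M dm2 loc Po Ks Kv Ko Φ A Ψ =
      (A (fun ℓ => isEmptyElim ℓ) * Ψ (fun ℓ => isEmptyElim ℓ)) *
        (M.C.e ^ 2 * P.mesh 0 / 2 * ∑ b ∈ M.S, (loc (vx1 nbar hn2)).wB b * (P.mesh 0 ^ P.d * M.g b.src ^ 2 * Kv (vline1 nbar hn2) b b *
          ∑ p : HiggsLattice.Site P 0 × Fin N, ∑ c : Fin N,
            ⟪covDeriv M.C M.B (basisE p) b, (M.C.q ^ 2) (EuclideanSpace.single c (1 : ℝ))⟫_ℝ * Φ (dExt p (b.src, c)))) := by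
  haveI : IsEmpty (Po.Line oRank) := ⟨fun l => IsEmpty.false l.1⟩
  haveI : IsEmpty Po.Ext := ⟨fun l => IsEmpty.false l.1⟩
  have hV : ∀ (α : SLeg kindD → HiggsLattice.Site P 0 × Fin N) (β : VLeg kindD → HiggsLattice.PBond P 0)
      (ο : OLeg kindD → HiggsLattice.Site P k × Fin N),
      vertexFactor (rulesOf (g321a nbar hn2) M dm2 loc) basisE basisV basisE α β ο =
        rule18 M.C M.g M.B M.At 2 0 M.S (loc (vx1 nbar hn2)).wB (fun j => basisE (α (sd j))) (fun j => basisV (β (vd j))) := by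
    intro α β ο
    unfold vertexFactor
    exact Fin.prod_univ_one _
  have hs : ∀ α : SLeg kindD → HiggsLattice.Site P 0 × Fin N, sLineFactor (G := g321a nbar hn2) Ks α = 1 := by
    intro α
    unfold sLineFactor
    exact Fintype.prod_empty _
  have hv : ∀ β : VLeg kindD → HiggsLattice.PBond P 0, vLineFactor Kv β = Kv (vline1 nbar hn2) (β (vd 0)) (β (vd 1)) := by
    intro β
    unfold vLineFactor
    rw [Fintype.prod_unique]
    show Kv (vline1 nbar hn2) (β (vd 0)) (β ((vPairing (g321a nbar hn2)).mate (vd 0))) = _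
    rw [vmate1]
  have ho : ∀ ο : OLeg kindD → HiggsLattice.Site P k × Fin N, oLineFactor Po Ko ο = 1 := by
    intro ο
    unfold oLineFactor
    exact Fintype.prod_empty _
  have hA : ∀ β : VLeg kindD → HiggsLattice.PBond P 0, (fun ℓ : ExtVLeg (g321a nbar hn2) => β ℓ.1) = fun ℓ => isEmptyElim ℓ :=
    fun β => funext fun ℓ => isEmptyElim ℓ
  have hΨ : ∀ ο : OLeg kindD → HiggsLattice.Site P k × Fin N, (fun ℓ : Po.Ext => ο ℓ.1) = fun ℓ => isEmptyElim ℓ :=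
    fun ο => funext fun ℓ => isEmptyElim ℓ
  rw [graphAmp_eq1]
  simp only [Fintype.sum_unique, hV, hs, hv, ho, hA, hΨ, mul_one, one_mul, rule18_two_zero_basis, ext_fun_eq1]
  -- bond sum outermost
  have h1 : ∀ (α : SLeg kindD → HiggsLattice.Site P 0 × Fin N) (β : VLeg kindD → HiggsLattice.PBond P 0),
      (∑ b ∈ M.S, (M.C.e ^ 2 * P.mesh 0 / 2 * ((loc (vx1 nbar hn2)).wB b * P.mesh 0 ^ P.d)) *
          (((if b.src = (α (sd 1)).1 then (1 : ℝ) else 0) *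
              ⟪covDeriv M.C M.B (basisE (α (sd 0))) b, (M.C.q ^ 2) (EuclideanSpace.single (α (sd 1)).2 (1 : ℝ))⟫_ℝ) *
            ((if b = β (vd 0) ∧ b = β (vd 1) then (1 : ℝ) else 0) * M.g b.src ^ 2))) *
          (Φ (dExt (α (sd 0)) (α (sd 1))) * A (fun ℓ => isEmptyElim ℓ) * Ψ (fun ℓ => isEmptyElim ℓ)) *
          Kv (vline1 nbar hn2) (β (vd 0)) (β (vd 1)) =
        ∑ b ∈ M.S, (if b = β (vd 0) ∧ b = β (vd 1) then (1 : ℝ) else 0) *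
          (Kv (vline1 nbar hn2) (β (vd 0)) (β (vd 1)) * ((A (fun ℓ => isEmptyElim ℓ) * Ψ (fun ℓ => isEmptyElim ℓ)) *
            (M.C.e ^ 2 * P.mesh 0 / 2 * ((loc (vx1 nbar hn2)).wB b * (P.mesh 0 ^ P.d * M.g b.src ^ 2))) *
            ((if b.src = (α (sd 1)).1 then (1 : ℝ) else 0) *
              (⟪covDeriv M.C M.B (basisE (α (sd 0))) b, (M.C.q ^ 2) (EuclideanSpace.single (α (sd 1)).2 (1 : ℝ))⟫_ℝ *
                Φ (dExt (α (sd 0)) (α (sd 1))))))) := by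
    intro α β
    rw [Finset.sum_mul, Finset.sum_mul]
    exact Finset.sum_congr rfl fun b _ => by ring
  rw [Finset.sum_congr rfl fun α _ => Finset.sum_congr rfl fun β _ => h1 α β]
  have h2 : ∀ α : SLeg kindD → HiggsLattice.Site P 0 × Fin N,
      ∑ β : VLeg kindD → HiggsLattice.PBond P 0, ∑ b ∈ M.S, (if b = β (vd 0) ∧ b = β (vd 1) then (1 : ℝ) else 0) *
          (Kv (vline1 nbar hn2) (β (vd 0)) (β (vd 1)) * ((A (fun ℓ => isEmptyElim ℓ) * Ψ (fun ℓ => isEmptyElim ℓ)) *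
            (M.C.e ^ 2 * P.mesh 0 / 2 * ((loc (vx1 nbar hn2)).wB b * (P.mesh 0 ^ P.d * M.g b.src ^ 2))) *
            ((if b.src = (α (sd 1)).1 then (1 : ℝ) else 0) *
              (⟪covDeriv M.C M.B (basisE (α (sd 0))) b, (M.C.q ^ 2) (EuclideanSpace.single (α (sd 1)).2 (1 : ℝ))⟫_ℝ *
                Φ (dExt (α (sd 0)) (α (sd 1))))))) =
        ∑ b ∈ M.S, Kv (vline1 nbar hn2) b b * ((A (fun ℓ => isEmptyElim ℓ) * Ψ (fun ℓ => isEmptyElim ℓ)) *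
            (M.C.e ^ 2 * P.mesh 0 / 2 * ((loc (vx1 nbar hn2)).wB b * (P.mesh 0 ^ P.d * M.g b.src ^ 2))) *
            ((if b.src = (α (sd 1)).1 then (1 : ℝ) else 0) *
              (⟪covDeriv M.C M.B (basisE (α (sd 0))) b, (M.C.q ^ 2) (EuclideanSpace.single (α (sd 1)).2 (1 : ℝ))⟫_ℝ *
                Φ (dExt (α (sd 0)) (α (sd 1)))))) := by
    intro α
    rw [Finset.sum_comm]
    refine Finset.sum_congr rfl fun b _ => ?_
    rw [beta_sumD b fun β => Kv (vline1 nbar hn2) (β (vd 0)) (β (vd 1)) * ((A (fun ℓ => isEmptyElim ℓ) * Ψ (fun ℓ => isEmptyElim ℓ)) *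
            (M.C.e ^ 2 * P.mesh 0 / 2 * ((loc (vx1 nbar hn2)).wB b * (P.mesh 0 ^ P.d * M.g b.src ^ 2))) *
            ((if b.src = (α (sd 1)).1 then (1 : ℝ) else 0) *
              (⟪covDeriv M.C M.B (basisE (α (sd 0))) b, (M.C.q ^ 2) (EuclideanSpace.single (α (sd 1)).2 (1 : ℝ))⟫_ℝ *
                Φ (dExt (α (sd 0)) (α (sd 1))))))]
  rw [Finset.sum_congr rfl fun α _ => h2 α, Finset.sum_comm, Finset.mul_sum, Finset.mul_sum]
  refine Finset.sum_congr rfl fun b _ => ?_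
  have h3 : ∀ α : SLeg kindD → HiggsLattice.Site P 0 × Fin N,
      Kv (vline1 nbar hn2) b b * ((A (fun ℓ => isEmptyElim ℓ) * Ψ (fun ℓ => isEmptyElim ℓ)) *
            (M.C.e ^ 2 * P.mesh 0 / 2 * ((loc (vx1 nbar hn2)).wB b * (P.mesh 0 ^ P.d * M.g b.src ^ 2))) *
            ((if b.src = (α (sd 1)).1 then (1 : ℝ) else 0) *
              (⟪covDeriv M.C M.B (basisE (α (sd 0))) b, (M.C.q ^ 2) (EuclideanSpace.single (α (sd 1)).2 (1 : ℝ))⟫_ℝ *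
                Φ (dExt (α (sd 0)) (α (sd 1)))))) =
        (Kv (vline1 nbar hn2) b b * (A (fun ℓ => isEmptyElim ℓ) * Ψ (fun ℓ => isEmptyElim ℓ)) *
            (M.C.e ^ 2 * P.mesh 0 / 2 * ((loc (vx1 nbar hn2)).wB b * (P.mesh 0 ^ P.d * M.g b.src ^ 2)))) *
          ((if b.src = (α (sd 1)).1 then (1 : ℝ) else 0) *
            (⟪covDeriv M.C M.B (basisE (α (sd 0))) b, (M.C.q ^ 2) (EuclideanSpace.single (α (sd 1)).2 (1 : ℝ))⟫_ℝ *
              Φ (dExt (α (sd 0)) (α (sd 1))))) := by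
    intro α
    ring
  rw [Finset.sum_congr rfl fun α _ => h3 α, ← Finset.mul_sum,
    alpha_sumD b.src fun p r => ⟪covDeriv M.C M.B (basisE p) b, (M.C.q ^ 2) (EuclideanSpace.single r.2 (1 : ℝ))⟫_ℝ * Φ (dExt p r)]
  ring

/-- **(3.21)₁ for a product external field** (`φ′` in the differentiated leg, `φ` in the other): the external indices are summed INTO the
fields — `Σ_p φ′(p)[(D^η_B̃δ_p)(b)·q²e_c] = (D^η_B̃φ′)(b)·q²e_c` (linearity of `D^η_B̃`), `Σ_c (…·q²e_c) φ(b₋)_c = (D^η_B̃φ′)(b)·q²φ(b₋)`: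
`E = A(∅)Ψ(∅) · (e²η/2) Σ_{b∈S} w(b) η^d g_k(b₋)² Kv(b,b) [(D^η_B̃φ′)(b)·q²φ(b₋)]` — the vertex (1.8)_{2,0} (the typer's `vertex18 … 2 0`,
polarized) with its factor `(g_kA′_b)²` REPLACED BY `g_k(b₋)²·Kv(b,b)`, at ANY background `B̃`. [cite: Balaban1983Higgs3, (3.21) p.438]
[cite: Balaban1983Higgs3, (1.8) p.413] -/
theorem graphAmp_g321a_extS (M : Model P N k) (dm2 : Fin (g321a nbar hn2).nV → HiggsLattice.Site P 0 → ℝ)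
    (loc : Fin (g321a nbar hn2).nV → Loc P k) (Po : OutPairing (g321a nbar hn2))
    (Ks : SLine (g321a nbar hn2) → HiggsLattice.Site P 0 × Fin N → HiggsLattice.Site P 0 × Fin N → ℝ)
    (Kv : VLine (g321a nbar hn2) → HiggsLattice.PBond P 0 → HiggsLattice.PBond P 0 → ℝ)
    (Ko : Po.Line oRank → HiggsLattice.Site P k × Fin N → HiggsLattice.Site P k × Fin N → ℝ)
    (φs : ExtSLeg (g321a nbar hn2) → HiggsLattice.ScalarField P 0 N) (A : (ExtVLeg (g321a nbar hn2) → HiggsLattice.PBond P 0) → ℝ)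
    (Ψ : (Po.Ext → HiggsLattice.Site P k × Fin N) → ℝ) :
    graphAmp (g321a nbar hn2) M dm2 loc Po Ks Kv Ko (extS (g321a nbar hn2) φs) A Ψ =
      (A (fun ℓ => isEmptyElim ℓ) * Ψ (fun ℓ => isEmptyElim ℓ)) *
        (M.C.e ^ 2 * P.mesh 0 / 2 * ∑ b ∈ M.S, (loc (vx1 nbar hn2)).wB b * (P.mesh 0 ^ P.d * M.g b.src ^ 2 * Kv (vline1 nbar hn2) b b *
          ⟪covDeriv M.C M.B (φs (es1 nbar hn2 0)) b, (M.C.q ^ 2) (φs (es1 nbar hn2 1) b.src)⟫_ℝ)) := by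
  rw [graphAmp_g321a]
  simp only [extS_dExt]
  have h : ∀ b : HiggsLattice.PBond P 0, ∑ p : HiggsLattice.Site P 0 × Fin N, ∑ c : Fin N,
      ⟪covDeriv M.C M.B (basisE p) b, (M.C.q ^ 2) (EuclideanSpace.single c (1 : ℝ))⟫_ℝ *
        (φs (es1 nbar hn2 0) p.1 p.2 * φs (es1 nbar hn2 1) (b.src, c).1 (b.src, c).2) =
      ⟪covDeriv M.C M.B (φs (es1 nbar hn2 0)) b, (M.C.q ^ 2) (φs (es1 nbar hn2 1) b.src)⟫_ℝ := by
    intro b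
    rw [Finset.sum_comm]
    have h1 : ∀ c : Fin N, ∑ p : HiggsLattice.Site P 0 × Fin N, ⟪covDeriv M.C M.B (basisE p) b, (M.C.q ^ 2) (EuclideanSpace.single c (1 : ℝ))⟫_ℝ *
        (φs (es1 nbar hn2 0) p.1 p.2 * φs (es1 nbar hn2 1) (b.src, c).1 (b.src, c).2) =
        ⟪covDeriv M.C M.B (φs (es1 nbar hn2 0)) b, (M.C.q ^ 2) (EuclideanSpace.single c (1 : ℝ))⟫_ℝ * φs (es1 nbar hn2 1) b.src c := by
      intro c
      rw [← sum_coord_covDeriv_basisE M.C M.B (φs (es1 nbar hn2 0)) b, Finset.sum_mul]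
      exact Finset.sum_congr rfl fun p _ => by ring
    simp only [h1]
    exact sum_inner_T_single (M.C.q ^ 2) _ _
  simp only [h]

end EvalA

/-! ## §4 The evaluator on (3.21)₂: the closed form -/

section EvalB

variable {P : HiggsLattice.Params} {N k : ℕ} {hn : 1 ≤ nbar}
variable [DecidableEq (HiggsLattice.PBond P 0)]

/-- The evaluator on (3.21)₂ with `kind36`-typed index assignments — FILE 1's `amp` unfolded. [cite: Balaban1983Higgs3, p.420] -/
theorem graphAmp_eq2 (M : Model P N k) (dm2 : Fin (g321b nbar hn).nV → HiggsLattice.Site P 0 → ℝ)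
    (loc : Fin (g321b nbar hn).nV → Loc P k) (Po : OutPairing (g321b nbar hn))
    (Ks : SLine (g321b nbar hn) → HiggsLattice.Site P 0 × Fin N → HiggsLattice.Site P 0 × Fin N → ℝ)
    (Kv : VLine (g321b nbar hn) → HiggsLattice.PBond P 0 → HiggsLattice.PBond P 0 → ℝ)
    (Ko : Po.Line oRank → HiggsLattice.Site P k × Fin N → HiggsLattice.Site P k × Fin N → ℝ)
    (Φ : (ExtSLeg (g321b nbar hn) → HiggsLattice.Site P 0 × Fin N) → ℝ) (A : (ExtVLeg (g321b nbar hn) → HiggsLattice.PBond P 0) → ℝ)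
    (Ψ : (Po.Ext → HiggsLattice.Site P k × Fin N) → ℝ) :
    graphAmp (g321b nbar hn) M dm2 loc Po Ks Kv Ko Φ A Ψ =
      ∑ α : SLeg kind36 → HiggsLattice.Site P 0 × Fin N, ∑ β : VLeg kind36 → HiggsLattice.PBond P 0,
        ∑ ο : OLeg kind36 → HiggsLattice.Site P k × Fin N,
          vertexFactor (rulesOf (g321b nbar hn) M dm2 loc) basisE basisV basisE α β ο *
            (Φ (fun ℓ => α ℓ.1) * A (fun ℓ => β ℓ.1) * Ψ (fun ℓ => ο ℓ.1)) *
            (sLineFactor Ks α * vLineFactor Kv β * oLineFactor Po Ko ο) := rfl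

/-- kernel: the product of the two vertex sums against the remaining factors, rearranged with the bond sums outermost. [folklore] -/
private theorem rearrange2 {ι κ μ : Type*} [Fintype ι] [Fintype κ] (s : Finset μ) (e : ℝ) (A₀ A₁ : μ → ι → κ → ℝ) (X Y : ι → κ → ℝ) :
    ∑ α, ∑ β, -e * (∑ b ∈ s, A₀ b α β) * (-e * ∑ b' ∈ s, A₁ b' α β) * X α β * Y α β =
      e ^ 2 * ∑ b ∈ s, ∑ b' ∈ s, ∑ α, ∑ β, A₀ b α β * (A₁ b' α β * (X α β * Y α β)) := by
  have h1 : ∀ α β, -e * (∑ b ∈ s, A₀ b α β) * (-e * ∑ b' ∈ s, A₁ b' α β) * X α β * Y α β =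
      ∑ b ∈ s, ∑ b' ∈ s, e ^ 2 * (A₀ b α β * (A₁ b' α β * (X α β * Y α β))) := by
    intro α β
    calc -e * (∑ b ∈ s, A₀ b α β) * (-e * ∑ b' ∈ s, A₁ b' α β) * X α β * Y α β
        = e ^ 2 * (X α β * Y α β) * ((∑ b ∈ s, A₀ b α β) * ∑ b' ∈ s, A₁ b' α β) := by ring
      _ = e ^ 2 * (X α β * Y α β) * ∑ b ∈ s, ∑ b' ∈ s, A₀ b α β * A₁ b' α β := by rw [Finset.sum_mul_sum]
      _ = ∑ b ∈ s, ∑ b' ∈ s, e ^ 2 * (A₀ b α β * (A₁ b' α β * (X α β * Y α β))) := by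
          rw [Finset.mul_sum]
          refine Finset.sum_congr rfl fun b _ => ?_
          rw [Finset.mul_sum]
          refine Finset.sum_congr rfl fun b' _ => ?_
          ring
  simp only [h1]
  have h2 : ∀ α, ∑ β, ∑ b ∈ s, ∑ b' ∈ s, e ^ 2 * (A₀ b α β * (A₁ b' α β * (X α β * Y α β))) =
      ∑ b ∈ s, ∑ b' ∈ s, ∑ β, e ^ 2 * (A₀ b α β * (A₁ b' α β * (X α β * Y α β))) := by
    intro α
    rw [Finset.sum_comm]
    exact Finset.sum_congr rfl fun b _ => Finset.sum_comm
  simp only [h2]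
  rw [Finset.sum_comm, Finset.mul_sum]
  refine Finset.sum_congr rfl fun b _ => ?_
  rw [Finset.sum_comm, Finset.mul_sum]
  refine Finset.sum_congr rfl fun b' _ => ?_
  rw [Finset.mul_sum]
  refine Finset.sum_congr rfl fun α _ => ?_
  rw [Finset.mul_sum]

/-- **The evaluator EVALUATED on the picture (3.21)₂** (two vertices (1.8)_{1,0} at the bonds `b ∋ x`, `b′ ∋ x′`; the A′-line *"replaced
by the corresponding propagator"* `Kv(b,b′)`; the φ′-line from the differentiated leg of `x` to the undifferentiated leg of `x′`,
differentiated at its `x`-end (`dK1`); external: the undifferentiated leg of `x` at `(b₋, c)` and the DIFFERENTIATED leg of `x′` with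
its free index `p′`): for ANY joint external field `Φ`,
`E = A(∅)Ψ(∅) · e² Σ_{b,b′∈S} w₀(b)w₁(b′) η^{2d} g_k(b₋)g_k(b′₋) Kv(b,b′) Σ_{p′,c,c′} dK1(Ks)(b, qe_c; (b′₋,c′))·[(D^η_B̃δ_{p′})(b′)·qe_{c′}]·
Φ((b₋,c), p′)`. [cite: Balaban1983Higgs3, (3.21) p.438] [cite: Balaban1983Higgs3, (1.8) p.413] [cite: Balaban1983Higgs3, p.414] -/
theorem graphAmp_g321b (M : Model P N k) (dm2 : Fin (g321b nbar hn).nV → HiggsLattice.Site P 0 → ℝ)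
    (loc : Fin (g321b nbar hn).nV → Loc P k) (Po : OutPairing (g321b nbar hn))
    (Ks : SLine (g321b nbar hn) → HiggsLattice.Site P 0 × Fin N → HiggsLattice.Site P 0 × Fin N → ℝ)
    (Kv : VLine (g321b nbar hn) → HiggsLattice.PBond P 0 → HiggsLattice.PBond P 0 → ℝ)
    (Ko : Po.Line oRank → HiggsLattice.Site P k × Fin N → HiggsLattice.Site P k × Fin N → ℝ)
    (Φ : (ExtSLeg (g321b nbar hn) → HiggsLattice.Site P 0 × Fin N) → ℝ) (A : (ExtVLeg (g321b nbar hn) → HiggsLattice.PBond P 0) → ℝ)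
    (Ψ : (Po.Ext → HiggsLattice.Site P k × Fin N) → ℝ) :
    graphAmp (g321b nbar hn) M dm2 loc Po Ks Kv Ko Φ A Ψ =
      (A (fun ℓ => isEmptyElim ℓ) * Ψ (fun ℓ => isEmptyElim ℓ)) *
        (M.C.e ^ 2 * ∑ b ∈ M.S, ∑ b' ∈ M.S, (loc (vx2 nbar hn 0)).wB b * (loc (vx2 nbar hn 1)).wB b' *
          ((P.mesh 0 ^ P.d) ^ 2 * (M.g b.src * M.g b'.src) * Kv (vline2 nbar hn) b b' *
            ∑ p' : HiggsLattice.Site P 0 × Fin N, ∑ c : Fin N, ∑ c' : Fin N,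
              dK1 M.C M.B (Ks (sline2 nbar hn)) b (M.C.q (EuclideanSpace.single c (1 : ℝ))) (b'.src, c') *
                dq M.C M.B p' b' c' * Φ (bExt (b.src, c) p'))) := by
  haveI : IsEmpty (Po.Line oRank) := ⟨fun l => IsEmpty.false l.1⟩
  haveI : IsEmpty Po.Ext := ⟨fun l => IsEmpty.false l.1⟩
  have hV : ∀ (α : SLeg kind36 → HiggsLattice.Site P 0 × Fin N) (β : VLeg kind36 → HiggsLattice.PBond P 0)
      (ο : OLeg kind36 → HiggsLattice.Site P k × Fin N),
      vertexFactor (rulesOf (g321b nbar hn) M dm2 loc) basisE basisV basisE α β ο =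
        rule18 M.C M.g M.B M.At 1 0 M.S (loc (vx2 nbar hn 0)).wB (fun j => basisE (α (ta 0 j))) (fun j => basisV (β ⟨0, j⟩)) *
          rule18 M.C M.g M.B M.At 1 0 M.S (loc (vx2 nbar hn 1)).wB (fun j => basisE (α (ta 1 j))) (fun j => basisV (β ⟨1, j⟩)) := by
    intro α β ο
    unfold vertexFactor
    exact Fin.prod_univ_two _
  have hs : ∀ α : SLeg kind36 → HiggsLattice.Site P 0 × Fin N, sLineFactor Ks α = Ks (sline2 nbar hn) (α (ta 0 0)) (α (ta 1 1)) := by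
    intro α
    unfold sLineFactor
    rw [Fintype.prod_unique]
    show Ks (sline2 nbar hn) (α (ta 0 0)) (α ((sPairing (g321b nbar hn)).mate (ta 0 0))) = _
    rw [mate2.1]
  have hv : ∀ β : VLeg kind36 → HiggsLattice.PBond P 0, vLineFactor Kv β = Kv (vline2 nbar hn) (β (tv 0)) (β (tv 1)) := by
    intro β
    unfold vLineFactor
    rw [Fintype.prod_unique]
    show Kv (vline2 nbar hn) (β (tv 0)) (β ((vPairing (g321b nbar hn)).mate (tv 0))) = _
    rw [mate2.2]
  have ho : ∀ ο : OLeg kind36 → HiggsLattice.Site P k × Fin N, oLineFactor Po Ko ο = 1 := by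
    intro ο
    unfold oLineFactor
    exact Fintype.prod_empty _
  have hA : ∀ β : VLeg kind36 → HiggsLattice.PBond P 0, (fun ℓ : ExtVLeg (g321b nbar hn) => β ℓ.1) = fun ℓ => isEmptyElim ℓ :=
    fun β => funext fun ℓ => isEmptyElim ℓ
  have hΨ : ∀ ο : OLeg kind36 → HiggsLattice.Site P k × Fin N, (fun ℓ : Po.Ext => ο ℓ.1) = fun ℓ => isEmptyElim ℓ :=
    fun ο => funext fun ℓ => isEmptyElim ℓ
  rw [graphAmp_eq2]
  simp only [Fintype.sum_unique, hV, hs, hv, ho, hA, hΨ, mul_one, rule18_basis, ext_fun_eq2]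
  -- bond sums outermost
  have h := rearrange2 M.S M.C.e
    (fun b (α : SLeg kind36 → HiggsLattice.Site P 0 × Fin N) (β : VLeg kind36 → HiggsLattice.PBond P 0) =>
      vterm M (loc (vx2 nbar hn 0)).wB b (α (ta 0 0)) (α (ta 0 1)) (β (tv 0)))
    (fun b (α : SLeg kind36 → HiggsLattice.Site P 0 × Fin N) (β : VLeg kind36 → HiggsLattice.PBond P 0) =>
      vterm M (loc (vx2 nbar hn 1)).wB b (α (ta 1 0)) (α (ta 1 1)) (β (tv 1)))
    (fun α _ => Φ (bExt (α (ta 0 1)) (α (ta 1 0))) * A (fun ℓ => isEmptyElim ℓ) * Ψ (fun ℓ => isEmptyElim ℓ))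
    (fun α β => Ks (sline2 nbar hn) (α (ta 0 0)) (α (ta 1 1)) * Kv (vline2 nbar hn) (β (tv 0)) (β (tv 1)))
  beta_reduce at h
  rw [h, mul_left_comm _ (M.C.e ^ 2) _]
  congr 1
  rw [Finset.mul_sum]
  refine Finset.sum_congr rfl fun b _ => ?_
  rw [Finset.mul_sum]
  refine Finset.sum_congr rfl fun b' _ => ?_
  -- the summand with the two bond deltas in front
  have h2 : ∀ (α : SLeg kind36 → HiggsLattice.Site P 0 × Fin N) (β : VLeg kind36 → HiggsLattice.PBond P 0),
      vterm M (loc (vx2 nbar hn 0)).wB b (α (ta 0 0)) (α (ta 0 1)) (β (tv 0)) *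
          (vterm M (loc (vx2 nbar hn 1)).wB b' (α (ta 1 0)) (α (ta 1 1)) (β (tv 1)) *
            (Φ (bExt (α (ta 0 1)) (α (ta 1 0))) * A (fun ℓ => isEmptyElim ℓ) * Ψ (fun ℓ => isEmptyElim ℓ) *
              (Ks (sline2 nbar hn) (α (ta 0 0)) (α (ta 1 1)) * Kv (vline2 nbar hn) (β (tv 0)) (β (tv 1))))) =
        (if b = β (tv 0) then (1 : ℝ) else 0) * ((if b' = β (tv 1) then (1 : ℝ) else 0) *
          (Kv (vline2 nbar hn) (β (tv 0)) (β (tv 1)) * ((A (fun ℓ => isEmptyElim ℓ) * Ψ (fun ℓ => isEmptyElim ℓ)) *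
            ((loc (vx2 nbar hn 0)).wB b * (P.mesh 0 ^ P.d * M.g b.src) * ((loc (vx2 nbar hn 1)).wB b' * (P.mesh 0 ^ P.d * M.g b'.src))) *
            ((if b.src = (α (ta 0 1)).1 then (1 : ℝ) else 0) * ((if b'.src = (α (ta 1 1)).1 then (1 : ℝ) else 0) *
              (dq M.C M.B (α (ta 0 0)) b (α (ta 0 1)).2 * dq M.C M.B (α (ta 1 0)) b' (α (ta 1 1)).2 *
                Ks (sline2 nbar hn) (α (ta 0 0)) (α (ta 1 1)) * Φ (bExt (α (ta 0 1)) (α (ta 1 0))))))))) := by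
    intro α β
    unfold vterm
    ring
  rw [Finset.sum_congr rfl fun α _ => Finset.sum_congr rfl fun β _ => h2 α β]
  -- the A′-leg sum: the A′-line kernel between b and b′
  have h3 : ∀ α : SLeg kind36 → HiggsLattice.Site P 0 × Fin N,
      ∑ β : VLeg kind36 → HiggsLattice.PBond P 0, (if b = β (tv 0) then (1 : ℝ) else 0) * ((if b' = β (tv 1) then (1 : ℝ) else 0) *
          (Kv (vline2 nbar hn) (β (tv 0)) (β (tv 1)) * ((A (fun ℓ => isEmptyElim ℓ) * Ψ (fun ℓ => isEmptyElim ℓ)) *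
            ((loc (vx2 nbar hn 0)).wB b * (P.mesh 0 ^ P.d * M.g b.src) * ((loc (vx2 nbar hn 1)).wB b' * (P.mesh 0 ^ P.d * M.g b'.src))) *
            ((if b.src = (α (ta 0 1)).1 then (1 : ℝ) else 0) * ((if b'.src = (α (ta 1 1)).1 then (1 : ℝ) else 0) *
              (dq M.C M.B (α (ta 0 0)) b (α (ta 0 1)).2 * dq M.C M.B (α (ta 1 0)) b' (α (ta 1 1)).2 *
                Ks (sline2 nbar hn) (α (ta 0 0)) (α (ta 1 1)) * Φ (bExt (α (ta 0 1)) (α (ta 1 0))))))))) =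
        Kv (vline2 nbar hn) b b' * ((A (fun ℓ => isEmptyElim ℓ) * Ψ (fun ℓ => isEmptyElim ℓ)) *
            ((loc (vx2 nbar hn 0)).wB b * (P.mesh 0 ^ P.d * M.g b.src) * ((loc (vx2 nbar hn 1)).wB b' * (P.mesh 0 ^ P.d * M.g b'.src))) *
            ((if b.src = (α (ta 0 1)).1 then (1 : ℝ) else 0) * ((if b'.src = (α (ta 1 1)).1 then (1 : ℝ) else 0) *
              (dq M.C M.B (α (ta 0 0)) b (α (ta 0 1)).2 * dq M.C M.B (α (ta 1 0)) b' (α (ta 1 1)).2 *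
                Ks (sline2 nbar hn) (α (ta 0 0)) (α (ta 1 1)) * Φ (bExt (α (ta 0 1)) (α (ta 1 0))))))) := by
    intro α
    rw [beta_sum2]
    rw [(bAssign_apply b b').1, (bAssign_apply b b').2]
  rw [Finset.sum_congr rfl fun α _ => h3 α, ← Finset.mul_sum, ← Finset.mul_sum]
  -- the φ′-leg sum
  have h4 := alpha_sum2' (N := N) b.src b'.src fun p p' r r' =>
    dq M.C M.B p b r.2 * dq M.C M.B p' b' r'.2 * Ks (sline2 nbar hn) p r' * Φ (bExt r p')
  beta_reduce at h4
  rw [h4]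
  -- the two index forms of the φ′-line agree
  have h5 : ∑ p : HiggsLattice.Site P 0 × Fin N, ∑ p' : HiggsLattice.Site P 0 × Fin N, ∑ c : Fin N, ∑ c' : Fin N,
      dq M.C M.B p b (b.src, c).2 * dq M.C M.B p' b' (b'.src, c').2 * Ks (sline2 nbar hn) p (b'.src, c') * Φ (bExt (b.src, c) p') =
      ∑ p' : HiggsLattice.Site P 0 × Fin N, ∑ c : Fin N, ∑ c' : Fin N,
        dK1 M.C M.B (Ks (sline2 nbar hn)) b (M.C.q (EuclideanSpace.single c (1 : ℝ))) (b'.src, c') *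
          dq M.C M.B p' b' c' * Φ (bExt (b.src, c) p') := by
    rw [Finset.sum_comm]
    refine Finset.sum_congr rfl fun p' _ => ?_
    simp only [dK1_single, Finset.sum_mul]
    rw [Finset.sum_comm]
    refine Finset.sum_congr rfl fun c _ => ?_
    rw [Finset.sum_comm]
    exact Finset.sum_congr rfl fun c' _ => Finset.sum_congr rfl fun p _ => by ring
  rw [h5]
  ring

/-- **(3.21)₂ for a product external field** (`φ` in the leg at `x`, `φ′` in the differentiated leg at `x′`): the index of the external
differentiated leg is summed INTO `φ′` (`sum_coord_covDeriv_basisE`), the index of the leg at `x` into `φ` (`sum_dK1_single`):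
`E = A(∅)Ψ(∅) · e² Σ_{b,b′∈S} w₀w₁ η^{2d} g_kg_k Kv(b,b′) Σ_{c′} dK1(Ks)(b, qφ(b₋); (b′₋,c′))·[(D^η_B̃φ′)(b′)·qe_{c′}]`.
[cite: Balaban1983Higgs3, (3.21) p.438] [cite: Balaban1983Higgs3, (1.8) p.413] -/
theorem graphAmp_g321b_extS (M : Model P N k) (dm2 : Fin (g321b nbar hn).nV → HiggsLattice.Site P 0 → ℝ)
    (loc : Fin (g321b nbar hn).nV → Loc P k) (Po : OutPairing (g321b nbar hn))
    (Ks : SLine (g321b nbar hn) → HiggsLattice.Site P 0 × Fin N → HiggsLattice.Site P 0 × Fin N → ℝ)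
    (Kv : VLine (g321b nbar hn) → HiggsLattice.PBond P 0 → HiggsLattice.PBond P 0 → ℝ)
    (Ko : Po.Line oRank → HiggsLattice.Site P k × Fin N → HiggsLattice.Site P k × Fin N → ℝ)
    (φs : ExtSLeg (g321b nbar hn) → HiggsLattice.ScalarField P 0 N) (A : (ExtVLeg (g321b nbar hn) → HiggsLattice.PBond P 0) → ℝ)
    (Ψ : (Po.Ext → HiggsLattice.Site P k × Fin N) → ℝ) :
    graphAmp (g321b nbar hn) M dm2 loc Po Ks Kv Ko (extS (g321b nbar hn) φs) A Ψ =
      (A (fun ℓ => isEmptyElim ℓ) * Ψ (fun ℓ => isEmptyElim ℓ)) *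
        (M.C.e ^ 2 * ∑ b ∈ M.S, ∑ b' ∈ M.S, (loc (vx2 nbar hn 0)).wB b * (loc (vx2 nbar hn 1)).wB b' *
          ((P.mesh 0 ^ P.d) ^ 2 * (M.g b.src * M.g b'.src) * Kv (vline2 nbar hn) b b' *
            ∑ c' : Fin N, dK1 M.C M.B (Ks (sline2 nbar hn)) b (M.C.q (φs (es2 nbar hn 0) b.src)) (b'.src, c') *
              ⟪covDeriv M.C M.B (φs (es2 nbar hn 1)) b', M.C.q (EuclideanSpace.single c' (1 : ℝ))⟫_ℝ)) := by
  rw [graphAmp_g321b]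
  simp only [extS_bExt]
  have h : ∀ b b' : HiggsLattice.PBond P 0,
      ∑ p' : HiggsLattice.Site P 0 × Fin N, ∑ c : Fin N, ∑ c' : Fin N,
        dK1 M.C M.B (Ks (sline2 nbar hn)) b (M.C.q (EuclideanSpace.single c (1 : ℝ))) (b'.src, c') * dq M.C M.B p' b' c' *
          (φs (es2 nbar hn 0) (b.src, c).1 (b.src, c).2 * φs (es2 nbar hn 1) p'.1 p'.2) =
      ∑ c' : Fin N, dK1 M.C M.B (Ks (sline2 nbar hn)) b (M.C.q (φs (es2 nbar hn 0) b.src)) (b'.src, c') *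
        ⟪covDeriv M.C M.B (φs (es2 nbar hn 1)) b', M.C.q (EuclideanSpace.single c' (1 : ℝ))⟫_ℝ := by
    intro b b'
    rw [Finset.sum_comm]
    have h1 : ∀ c : Fin N, ∑ p' : HiggsLattice.Site P 0 × Fin N, ∑ c' : Fin N,
        dK1 M.C M.B (Ks (sline2 nbar hn)) b (M.C.q (EuclideanSpace.single c (1 : ℝ))) (b'.src, c') * dq M.C M.B p' b' c' *
          (φs (es2 nbar hn 0) (b.src, c).1 (b.src, c).2 * φs (es2 nbar hn 1) p'.1 p'.2) =
        ∑ c' : Fin N, dK1 M.C M.B (Ks (sline2 nbar hn)) b (M.C.q (EuclideanSpace.single c (1 : ℝ))) (b'.src, c') * φs (es2 nbar hn 0) b.src c *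
          ⟪covDeriv M.C M.B (φs (es2 nbar hn 1)) b', M.C.q (EuclideanSpace.single c' (1 : ℝ))⟫_ℝ := by
      intro c
      rw [Finset.sum_comm]
      refine Finset.sum_congr rfl fun c' _ => ?_
      rw [← sum_coord_covDeriv_basisE M.C M.B (φs (es2 nbar hn 1)) b', Finset.mul_sum]
      unfold dq
      exact Finset.sum_congr rfl fun p' _ => by ring
    simp only [h1]
    rw [Finset.sum_comm]
    refine Finset.sum_congr rfl fun c' _ => ?_
    rw [← sum_dK1_single M.C M.B (Ks (sline2 nbar hn)) b M.C.q (φs (es2 nbar hn 0) b.src) (b'.src, c'), Finset.sum_mul]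
  simp only [h]

end EvalB

/-! ## §5 Zero background, free kernels: the values ARE `(e²/2)·expr321a` and `e²·expr321b` -/

section Free

variable {P : HiggsLattice.Params} {N k : ℕ} {hn : 1 ≤ nbar} {hn2 : 2 ≤ nbar}

/-- The forward difference quotient of a field, `(∂^η_μφ)(x) = c(φ(x+e_μ) − φ(x))`, `c = η⁻¹` — `LatticeFieldCalculus.pdiff` on the
(Higgs)₂,₃ carrier (the typer's `HiggsLattice.sderiv` read at the bond `⟨x, μ⟩`). [cite: Balaban1982Higgs1, (1.4) p.604] -/
def pdiffT (c : ℝ) (μ : Fin P.d) (φ : HiggsLattice.ScalarField P 0 N) (x : HiggsLattice.Site P 0) : HiggsCovariance.E N :=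
  c • (φ (x.shift μ) - φ x)

/-- at zero background the covariant derivative at `⟨x, μ⟩` is `pdiffT η⁻¹ μ`. [cite: Balaban1982Higgs1, (1.7) p.605] -/
theorem covDeriv_zero_eq_pdiffT (C : ChargeData N) (φ : HiggsLattice.ScalarField P 0 N) (x : HiggsLattice.Site P 0) (μ : Fin P.d) :
    covDeriv C (0 : HiggsLattice.VecField P 0) φ ⟨x, μ⟩ = pdiffT (P.mesh 0)⁻¹ μ φ x := by
  rw [HiggsLattice.covDeriv_zero]
  rfl

/-- **(3.21)₁ as an expression** (p18 g8's `B3Eq322OneLegDifferentiated.expr321a`, symbol by symbol on this carrier):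
`Σ_μ Σ_x η^d (η G(x,x) g(x) φ(x)·q(q(∂^η_μφ′)(x)))`. [cite: Balaban1983Higgs3, (3.21) p.438] -/
def expr321aT (η : ℝ) (q : HiggsCovariance.E N →L[ℝ] HiggsCovariance.E N) (G : HiggsLattice.Site P 0 → HiggsLattice.Site P 0 → ℝ)
    (g : HiggsLattice.Site P 0 → ℝ) (φ φ' : HiggsLattice.ScalarField P 0 N) : ℝ :=
  ∑ μ : Fin P.d, ∑ x : HiggsLattice.Site P 0, η ^ P.d * (η * G x x * g x * ⟪φ x, q (q (pdiffT η⁻¹ μ φ' x))⟫_ℝ)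

/-- **the two-point kernel of (3.21)₂** (p18's `ker321`): `k_μ(x,x′) = (∂^η_μG₀)(x,x′)g(x)G_j(x,x′)g′(x′)` — the φ′-line `G₀` differentiated
at its `x`-end (FILE 6's `dKernelL` = r15's `d1Kernel`), the A′-line `G_j`, the localization functions. [cite: Balaban1983Higgs3, (3.21) p.438] -/
def ker321T (η : ℝ) (μ : Fin P.d) (G0 Gj : HiggsLattice.Site P 0 → HiggsLattice.Site P 0 → ℝ) (g g' : HiggsLattice.Site P 0 → ℝ)
    (x x' : HiggsLattice.Site P 0) : ℝ :=
  dKernelL η⁻¹ μ G0 x x' * g x * Gj x x' * g' x'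

/-- **(3.21)₂ as an expression** (p18's `expr321b`): `Σ_μ Σ_{x,x′} η^{2d} (k_μ(x,x′) φ(x)·q(q(∂^η_μφ′)(x′)))`. [cite: Balaban1983Higgs3, (3.21) p.438] -/
def expr321bT (η : ℝ) (q : HiggsCovariance.E N →L[ℝ] HiggsCovariance.E N) (G0 Gj : HiggsLattice.Site P 0 → HiggsLattice.Site P 0 → ℝ)
    (g g' : HiggsLattice.Site P 0 → ℝ) (φ φ' : HiggsLattice.ScalarField P 0 N) : ℝ :=
  ∑ μ : Fin P.d, ∑ x : HiggsLattice.Site P 0, ∑ x' : HiggsLattice.Site P 0,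
    η ^ (2 * P.d) * (ker321T η μ G0 Gj g g' x x' * ⟪φ x, q (q (pdiffT η⁻¹ μ φ' x'))⟫_ℝ)

/-- kernel: a sum over the positively oriented bonds is the sum over initial points and directions. [folklore] -/
private theorem sum_bond {j : ℕ} (F : HiggsLattice.PBond P j → ℝ) :
    ∑ b, F b = ∑ x : HiggsLattice.Site P j, ∑ μ : Fin P.d, F ⟨x, μ⟩ := by
  let e : HiggsLattice.Site P j × Fin P.d ≃ HiggsLattice.PBond P j :=
    ⟨fun p => ⟨p.1, p.2⟩, fun b => (b.src, b.dir), fun _ => rfl, fun _ => rfl⟩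
  rw [← Fintype.sum_equiv e (fun p => F ⟨p.1, p.2⟩) F fun _ => rfl, Fintype.sum_prod_type]

variable [DecidableEq (HiggsLattice.PBond P 0)]

/-- **E((3.21)₁) AT ZERO BACKGROUND WITH THE FREE VECTOR KERNEL = `(e²/2)·expr321a`** (p. 438: *"The expression corresponding to the
first graph is in fact convergent, because ηG_k(x,x) is convergent"* — the factor `η·Kv(b,b)`): for `B̃ = 0`, all bonds, the site-valued
localization `g₀` of the vertex, the direction-diagonal vector kernel `[μ = μ′]G(x,x′)` on the A′-loop and the product external field
(`φ′` differentiated, `φ` plain): `E = A(∅)Ψ(∅)·(e²/2)·Σ_μ Σ_x η^d η G(x,x) g₀g_k²(x) φ(x)·q²(∂^η_μφ′)(x)` = `(e²/2)·expr321aT` with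
`g = g₀g_k²` (the `½` of `1/2!` stays: the A′-loop has one pairing). [cite: Balaban1983Higgs3, (3.21) p.438] -/
theorem graphAmp_g321a_free (M : Model P N k) (hB : M.B = 0) (hS : M.S = Finset.univ)
    (dm2 : Fin (g321a nbar hn2).nV → HiggsLattice.Site P 0 → ℝ) (loc : Fin (g321a nbar hn2).nV → Loc P k)
    (g₀ : HiggsLattice.Site P 0 → ℝ) (hw₀ : ∀ b, (loc (vx1 nbar hn2)).wB b = g₀ b.src)
    (Po : OutPairing (g321a nbar hn2)) (Ks : SLine (g321a nbar hn2) → HiggsLattice.Site P 0 × Fin N → HiggsLattice.Site P 0 × Fin N → ℝ)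
    (Kv : VLine (g321a nbar hn2) → HiggsLattice.PBond P 0 → HiggsLattice.PBond P 0 → ℝ)
    (Ko : Po.Line oRank → HiggsLattice.Site P k × Fin N → HiggsLattice.Site P k × Fin N → ℝ)
    (G : HiggsLattice.Site P 0 → HiggsLattice.Site P 0 → ℝ) (hKv : ∀ b b', Kv (vline1 nbar hn2) b b' = if b.dir = b'.dir then G b.src b'.src else 0)
    (φ φ' : HiggsLattice.ScalarField P 0 N) (A : (ExtVLeg (g321a nbar hn2) → HiggsLattice.PBond P 0) → ℝ)
    (Ψ : (Po.Ext → HiggsLattice.Site P k × Fin N) → ℝ) :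
    graphAmp (g321a nbar hn2) M dm2 loc Po Ks Kv Ko (extS (g321a nbar hn2) (pairExt1 φ φ')) A Ψ =
      (A (fun ℓ => isEmptyElim ℓ) * Ψ (fun ℓ => isEmptyElim ℓ)) *
        (M.C.e ^ 2 / 2 * expr321aT (P.mesh 0) M.C.q G (fun x => g₀ x * M.g x ^ 2) φ φ') := by
  rw [graphAmp_g321a_extS]
  obtain ⟨e0, e1⟩ := pairExt1_apply (hn2 := hn2) φ φ'
  simp only [e0, e1, hw₀, hKv, hS, hB, if_true]
  congr 1
  unfold expr321aT
  rw [Finset.sum_comm, sum_bond, Finset.mul_sum, Finset.mul_sum]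
  refine Finset.sum_congr rfl fun x _ => ?_
  rw [Finset.mul_sum, Finset.mul_sum]
  refine Finset.sum_congr rfl fun μ _ => ?_
  rw [covDeriv_zero_eq_pdiffT, sq_apply, inner_qq_symm M.C (pdiffT (P.mesh 0)⁻¹ μ φ' x) (φ x)]
  beta_reduce
  ring

/-- **E((3.21)₂) AT ZERO BACKGROUND WITH THE FREE KERNELS = `e²·expr321b`**: for `B̃ = 0`, all bonds, site-valued localizations `g₀`, `g₁`,
the free kernel `G₀ ⊗ 1_N` on the φ′-line and the direction-diagonal `[μ = μ′]G_j(x,x′)` on the A′-line, and the product external field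
(`φ` at `x`, `φ′` differentiated at `x′`): `E = A(∅)Ψ(∅)·e²·Σ_μ Σ_{x,x′} η^{2d} (∂^η_μG₀)(x,x′) g₀g_k(x) G_j(x,x′) g₁g_k(x′) φ(x)·q²(∂^η_μφ′)(x′)`
= `e²·expr321bT` — p18's (3.21)₂ expression, positive sign, the factor `e²` of the two vertices. [cite: Balaban1983Higgs3, (3.21) p.438]
[cite: Balaban1983Higgs3, (3.23) p.439] -/
theorem graphAmp_g321b_free (M : Model P N k) (hB : M.B = 0) (hS : M.S = Finset.univ)
    (dm2 : Fin (g321b nbar hn).nV → HiggsLattice.Site P 0 → ℝ) (loc : Fin (g321b nbar hn).nV → Loc P k)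
    (g₀ g₁ : HiggsLattice.Site P 0 → ℝ) (hw₀ : ∀ b, (loc (vx2 nbar hn 0)).wB b = g₀ b.src) (hw₁ : ∀ b, (loc (vx2 nbar hn 1)).wB b = g₁ b.src)
    (Po : OutPairing (g321b nbar hn)) (Ks : SLine (g321b nbar hn) → HiggsLattice.Site P 0 × Fin N → HiggsLattice.Site P 0 × Fin N → ℝ)
    (Kv : VLine (g321b nbar hn) → HiggsLattice.PBond P 0 → HiggsLattice.PBond P 0 → ℝ)
    (Ko : Po.Line oRank → HiggsLattice.Site P k × Fin N → HiggsLattice.Site P k × Fin N → ℝ)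
    (G0 Gj : HiggsLattice.Site P 0 → HiggsLattice.Site P 0 → ℝ)
    (hKs : ∀ p p', Ks (sline2 nbar hn) p p' = if p.2 = p'.2 then G0 p.1 p'.1 else 0)
    (hKv : ∀ b b', Kv (vline2 nbar hn) b b' = if b.dir = b'.dir then Gj b.src b'.src else 0)
    (φ φ' : HiggsLattice.ScalarField P 0 N) (A : (ExtVLeg (g321b nbar hn) → HiggsLattice.PBond P 0) → ℝ)
    (Ψ : (Po.Ext → HiggsLattice.Site P k × Fin N) → ℝ) :
    graphAmp (g321b nbar hn) M dm2 loc Po Ks Kv Ko (extS (g321b nbar hn) (pairExt2 φ φ')) A Ψ =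
      (A (fun ℓ => isEmptyElim ℓ) * Ψ (fun ℓ => isEmptyElim ℓ)) *
        (M.C.e ^ 2 * expr321bT (P.mesh 0) M.C.q G0 Gj (fun x => g₀ x * M.g x) (fun x => g₁ x * M.g x) φ φ') := by
  rw [graphAmp_g321b_extS]
  obtain ⟨e0, e1⟩ := pairExt2_apply (hn := hn) φ φ'
  have hK : Ks (sline2 nbar hn) = fun p p' => if p.2 = p'.2 then G0 p.1 p'.1 else 0 := funext fun p => funext fun p' => hKs p p'
  simp only [e0, e1, hw₀, hw₁, hKv, hK, hS, hB]
  congr 1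
  congr 1
  rw [sum_bond]
  simp only [sum_bond, dK1_zero_free, covDeriv_zero_eq_pdiffT]
  -- the direction delta of the A′-line and the internal-index contraction
  have h1 : ∀ (x : HiggsLattice.Site P 0) (μ : Fin P.d) (x' : HiggsLattice.Site P 0),
      ∑ μ' : Fin P.d, g₀ x * g₁ x' * ((P.mesh 0 ^ P.d) ^ 2 * (M.g x * M.g x') * (if μ = μ' then Gj x x' else 0) *
          ∑ c' : Fin N, dKernelL (P.mesh 0)⁻¹ μ G0 x x' * (M.C.q (φ x)) c' * ⟪pdiffT (P.mesh 0)⁻¹ μ' φ' x', M.C.q (EuclideanSpace.single c' (1 : ℝ))⟫_ℝ) =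
        g₀ x * g₁ x' * ((P.mesh 0 ^ P.d) ^ 2 * (M.g x * M.g x') * Gj x x' *
          (dKernelL (P.mesh 0)⁻¹ μ G0 x x' * ⟪φ x, M.C.q (M.C.q (pdiffT (P.mesh 0)⁻¹ μ φ' x'))⟫_ℝ)) := by
    intro x μ x'
    have h2 : ∀ μ' : Fin P.d, g₀ x * g₁ x' * ((P.mesh 0 ^ P.d) ^ 2 * (M.g x * M.g x') * (if μ = μ' then Gj x x' else 0) *
        ∑ c' : Fin N, dKernelL (P.mesh 0)⁻¹ μ G0 x x' * (M.C.q (φ x)) c' * ⟪pdiffT (P.mesh 0)⁻¹ μ' φ' x', M.C.q (EuclideanSpace.single c' (1 : ℝ))⟫_ℝ) =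
        if μ = μ' then g₀ x * g₁ x' * ((P.mesh 0 ^ P.d) ^ 2 * (M.g x * M.g x') * Gj x x' *
          ∑ c' : Fin N, dKernelL (P.mesh 0)⁻¹ μ G0 x x' * (M.C.q (φ x)) c' * ⟪pdiffT (P.mesh 0)⁻¹ μ' φ' x', M.C.q (EuclideanSpace.single c' (1 : ℝ))⟫_ℝ)
        else 0 := by
      intro μ'
      by_cases h : μ = μ' <;> simp [h]
    simp only [h2, Finset.sum_ite_eq, Finset.mem_univ, if_true]
    have h3 : ∑ c' : Fin N, dKernelL (P.mesh 0)⁻¹ μ G0 x x' * (M.C.q (φ x)) c' *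
        ⟪pdiffT (P.mesh 0)⁻¹ μ φ' x', M.C.q (EuclideanSpace.single c' (1 : ℝ))⟫_ℝ =
        dKernelL (P.mesh 0)⁻¹ μ G0 x x' * ⟪φ x, M.C.q (M.C.q (pdiffT (P.mesh 0)⁻¹ μ φ' x'))⟫_ℝ := by
      have h4 : ∀ c' : Fin N, dKernelL (P.mesh 0)⁻¹ μ G0 x x' * (M.C.q (φ x)) c' *
          ⟪pdiffT (P.mesh 0)⁻¹ μ φ' x', M.C.q (EuclideanSpace.single c' (1 : ℝ))⟫_ℝ =
          dKernelL (P.mesh 0)⁻¹ μ G0 x x' * (⟪pdiffT (P.mesh 0)⁻¹ μ φ' x', M.C.q (EuclideanSpace.single c' (1 : ℝ))⟫_ℝ * (M.C.q (φ x)) c') :=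
        fun c' => by ring
      simp only [h4, ← Finset.mul_sum, sum_inner_T_single]
      rw [inner_qq_symm M.C (pdiffT (P.mesh 0)⁻¹ μ φ' x') (φ x)]
    rw [h3]
  simp only [h1]
  unfold expr321bT ker321T
  conv_lhs => rw [Finset.sum_comm]
  refine Finset.sum_congr rfl fun μ _ => Finset.sum_congr rfl fun x _ => Finset.sum_congr rfl fun x' _ => ?_
  beta_reduce
  ring

end Free

/-! ## §6 The third graph of this kind (p18's `g321Y`, NOT drawn in (3.21)): its closed φ′-loop carries one `q` — at zero background
with the free scalar kernel the value VANISHES (`tr q = 0`) -/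

section EvalY

variable {hn : 1 ≤ nbar}

/-- The vertex `i` of `g321Y` (`i = 0`: the vertex with the φ′-loop, `i = 1`: the vertex with the two external legs).
[cite: Balaban1983Higgs3, (3.21) p.438] -/
def vxY (nbar : ℕ) (hn : 1 ≤ nbar) (i : Fin 2) : Fin (g321Y nbar hn).nV := i

/-- the pairing of the φ′-legs of `g321Y`: the two legs of vertex 0 joined, the two legs of vertex 1 external (p18's `g321Y.other`).
[cite: Balaban1983Higgs3, (3.21) p.438] -/
theorem sotherY :
    (sPairing (g321Y nbar hn)).other (ta 0 0) = some (ta 0 1) ∧ (sPairing (g321Y nbar hn)).other (ta 0 1) = some (ta 0 0) ∧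
      (sPairing (g321Y nbar hn)).other (ta 1 0) = none ∧ (sPairing (g321Y nbar hn)).other (ta 1 1) = none := by
  refine ⟨?_, ?_, ?_, ?_⟩
  · show spartner (g321Y nbar hn) (ta 0 0) = some (ta 0 1)
    exact (spartner_eq_some_iff _ _ _).2 rfl
  · show spartner (g321Y nbar hn) (ta 0 1) = some (ta 0 0)
    exact (spartner_eq_some_iff _ _ _).2 rfl
  · show spartner (g321Y nbar hn) (ta 1 0) = none
    exact (spartner_eq_none_iff _ _).2 rfl
  · show spartner (g321Y nbar hn) (ta 1 1) = none
    exact (spartner_eq_none_iff _ _).2 rfl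

/-- the A′-line of `g321Y`. [cite: Balaban1983Higgs3, (3.21) p.438] -/
theorem votherY (i : Fin 2) : (vPairing (g321Y nbar hn)).other (tv i) = some (tv i.rev) := by
  show vpartner (g321Y nbar hn) (tv i) = some (tv i.rev)
  refine (vpartner_eq_some_iff _ _ _).2 ?_
  fin_cases i <;> rfl

/-- `ta 0 0` (the differentiated leg of vertex 0) is the lower endpoint of the φ′-loop and the only lower φ′-leg.
[cite: Balaban1983Higgs3, (3.21) p.438] -/
theorem slowerY_iff : ∀ ℓ : SLeg (g321Y nbar hn).kind, (sPairing (g321Y nbar hn)).isLower sRank ℓ = true ↔ ℓ = ta 0 0 := by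
  show ∀ ℓ : SLeg (g321Y 1 le_rfl).kind, (sPairing (g321Y 1 le_rfl)).isLower sRank ℓ = true ↔ ℓ = ta 0 0
  decide

/-- `tv 0` is the only lower A′-leg. [cite: Balaban1983Higgs3, (3.21) p.438] -/
theorem vlowerY_iff : ∀ ℓ : VLeg (g321Y nbar hn).kind, (vPairing (g321Y nbar hn)).isLower vRank ℓ = true ↔ ℓ = tv 0 := by
  show ∀ ℓ : VLeg (g321Y 1 le_rfl).kind, (vPairing (g321Y 1 le_rfl)).isLower vRank ℓ = true ↔ ℓ = tv 0
  decide

/-- The φ′-loop of `g321Y` as a line (lower endpoint `ta 0 0`, mate `ta 0 1`). [cite: Balaban1983Higgs3, (3.21) p.438] -/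
def slineY (nbar : ℕ) (hn : 1 ≤ nbar) : SLine (g321Y nbar hn) := ⟨ta 0 0, (slowerY_iff _).2 rfl⟩

/-- The A′-line of `g321Y`. [cite: Balaban1983Higgs3, (3.21) p.438] -/
def vlineY (nbar : ℕ) (hn : 1 ≤ nbar) : VLine (g321Y nbar hn) := ⟨tv 0, (vlowerY_iff _).2 rfl⟩

/-- one φ′-line. [cite: Balaban1983Higgs3, (3.21) p.438] -/
instance uniqueSLineY : Unique (SLine (g321Y nbar hn)) where
  default := slineY nbar hn
  uniq := fun l => Subtype.ext ((slowerY_iff l.1).1 l.2)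

/-- one A′-line. [cite: Balaban1983Higgs3, (3.21) p.438] -/
instance uniqueVLineY : Unique (VLine (g321Y nbar hn)) where
  default := vlineY nbar hn
  uniq := fun l => Subtype.ext ((vlowerY_iff l.1).1 l.2)

/-- the mates: `ta 0 0 ↦ ta 0 1`, `tv 0 ↦ tv 1`. [cite: Balaban1983Higgs3, (3.21) p.438] -/
theorem mateY : (sPairing (g321Y nbar hn)).mate (ta 0 0) = ta 0 1 ∧ (vPairing (g321Y nbar hn)).mate (tv 0) = tv 1 :=
  ⟨(sPairing (g321Y nbar hn)).mate_eq sotherY.1, (vPairing (g321Y nbar hn)).mate_eq (votherY 0)⟩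

/-- `g321Y` has no external A′-leg. [cite: Balaban1983Higgs3, (3.21) p.438] -/
instance instIsEmptyExtVLegY : IsEmpty (ExtVLeg (g321Y nbar hn)) :=
  ⟨fun l => by
    have h := l.2
    rcases tv_cases l.1 with e | e <;> rw [e, votherY] at h <;> cases h⟩

/-- no averaging output. [cite: Balaban1983Higgs3, (3.21) p.438] -/
instance instIsEmptyOLegY : IsEmpty (OLeg (g321Y nbar hn).kind) := ⟨fun ℓ => Fin.elim0 (ℓ.2 : Fin 0)⟩

/-- The external φ′-legs of `g321Y` (both at vertex 1): `esY 0` = the undifferentiated leg `ta 1 1`, `esY 1` = the DIFFERENTIATED leg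
`ta 1 0`. [cite: Balaban1983Higgs3, (3.21) p.438] -/
def esY (nbar : ℕ) (hn : 1 ≤ nbar) : Fin 2 → ExtSLeg (g321Y nbar hn)
  | ⟨0, _⟩ => ⟨ta 1 1, sotherY.2.2.2⟩
  | ⟨1, _⟩ => ⟨ta 1 0, sotherY.2.2.1⟩

/-- `esY 0 ≠ esY 1`. [cite: Balaban1983Higgs3, (3.21) p.438] -/
theorem esY_ne : esY nbar hn 0 ≠ esY nbar hn 1 := by
  intro h
  have h' : ta 1 1 = ta 1 0 := congrArg Subtype.val h
  exact absurd (ta_injective2 _ _ _ _ h').2 (by decide)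

/-- every external φ′-leg of `g321Y` is `esY 0` or `esY 1`. [cite: Balaban1983Higgs3, (3.21) p.438] -/
theorem esY_cases (ℓ : ExtSLeg (g321Y nbar hn)) : ℓ = esY nbar hn 0 ∨ ℓ = esY nbar hn 1 := by
  have h := ℓ.2
  rcases ta_cases ℓ.1 with e | e | e | e
  · rw [e, sotherY.1] at h; cases h
  · right; exact Subtype.ext e
  · rw [e, sotherY.2.1] at h; cases h
  · left; exact Subtype.ext e

/-- the external φ′-legs of `g321Y` are exactly `esY 0`, `esY 1`. [cite: Balaban1983Higgs3, (3.21) p.438] -/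
theorem univ_extSLegY : (univ : Finset (ExtSLeg (g321Y nbar hn))) = {esY nbar hn 0, esY nbar hn 1} := by
  ext l
  simp only [Finset.mem_univ, Finset.mem_insert, Finset.mem_singleton, true_iff]
  exact esY_cases l

/-- The external-leg assignment of `g321Y` with `esY 0` at `r′` and `esY 1` (the differentiated leg) at `p′`. [cite: Balaban1983Higgs3, (3.21) p.438] -/
def yExt {X : Type*} (r' p' : X) : ExtSLeg (g321Y nbar hn) → X := fun ℓ => if ℓ = esY nbar hn 0 then r' else p'

/-- values of `yExt`. [cite: Balaban1983Higgs3, (3.21) p.438] -/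
theorem yExt_apply {X : Type*} (r' p' : X) : yExt (hn := hn) r' p' (esY nbar hn 0) = r' ∧ yExt (hn := hn) r' p' (esY nbar hn 1) = p' := by
  simp [yExt, (esY_ne (hn := hn)).symm]

/-- the restriction of an assignment to the external legs of `g321Y` is `yExt` of its values at `ta 1 1`, `ta 1 0`.
[cite: Balaban1983Higgs3, (3.21) p.438] -/
theorem ext_fun_eqY {X : Type*} (α : SLeg kind36 → X) :
    (fun ℓ : ExtSLeg (g321Y nbar hn) => α ℓ.1) = yExt (α (ta 1 1)) (α (ta 1 0)) := by
  funext ℓ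
  obtain ⟨e0, e1⟩ := yExt_apply (hn := hn) (α (ta 1 1)) (α (ta 1 0))
  rcases esY_cases ℓ with h | h <;> rw [h]
  · exact e0.symm
  · exact e1.symm

/-- A product external field read at `yExt r′ p′`. [cite: Balaban1983Higgs3, p.419] -/
theorem extS_yExt {P : HiggsLattice.Params} {N : ℕ} (φs : ExtSLeg (g321Y nbar hn) → HiggsLattice.ScalarField P 0 N)
    (r' p' : HiggsLattice.Site P 0 × Fin N) :
    extS (g321Y nbar hn) φs (yExt r' p') = φs (esY nbar hn 0) r'.1 r'.2 * φs (esY nbar hn 1) p'.1 p'.2 := by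
  unfold extS
  obtain ⟨e0, e1⟩ := yExt_apply (hn := hn) r' p'
  rw [show (∏ ℓ : ExtSLeg (g321Y nbar hn), φs ℓ (yExt r' p' ℓ).1 (yExt r' p' ℓ).2) =
      ∏ ℓ ∈ ({esY nbar hn 0, esY nbar hn 1} : Finset _), φs ℓ (yExt r' p' ℓ).1 (yExt r' p' ℓ).2 by rw [← univ_extSLegY],
    Finset.prod_pair esY_ne, e0, e1]

variable {P : HiggsLattice.Params} {N k : ℕ}

/-- `q` is antisymmetric: `u·qu = 0`. [cite: Balaban1982Higgs1, (1.7) p.605] -/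
theorem inner_q_self (C : ChargeData N) (u : HiggsCovariance.E N) : ⟪u, C.q u⟫_ℝ = 0 := by
  have h : ⟪u, C.q u⟫_ℝ = ⟪(star C.q) u, u⟫_ℝ := by
    rw [ContinuousLinearMap.star_eq_adjoint, ContinuousLinearMap.adjoint_inner_left]
  have h2 : (-C.q) u = -(C.q u) := rfl
  rw [C.q_skew, h2, inner_neg_left] at h
  have h3 := real_inner_comm (C.q u) u
  linarith

/-- the diagonal entries of `q` vanish: `e_c·qe_c = 0`, hence `tr q = 0`. [cite: Balaban1982Higgs1, (1.7) p.605] -/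
theorem sum_q_single_diag (C : ChargeData N) : ∑ c : Fin N, (C.q (EuclideanSpace.single c (1 : ℝ))) c = 0 := by
  refine Finset.sum_eq_zero fun c _ => ?_
  have h := inner_q_self C (EuclideanSpace.single c (1 : ℝ))
  rw [EuclideanSpace.inner_single_left, map_one, one_mul] at h
  exact h

/-- kernel: a four-fold sum of a product of two two-index factors is the product of the two double sums. [folklore] -/
private theorem sum4_factor {ι κ : Type*} [Fintype ι] [Fintype κ] (A B : ι → κ → ℝ) :
    ∑ p, ∑ p', ∑ c, ∑ c', A p c * B p' c' = (∑ c, ∑ p, A p c) * ∑ p', ∑ c', B p' c' := by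
  have h1 : ∀ p, ∑ p', ∑ c, ∑ c', A p c * B p' c' = ∑ c, A p c * ∑ p', ∑ c', B p' c' := by
    intro p
    rw [Finset.sum_comm]
    refine Finset.sum_congr rfl fun c _ => ?_
    rw [Finset.mul_sum]
    exact Finset.sum_congr rfl fun p' _ => by rw [Finset.mul_sum]
  simp only [h1]
  conv_lhs => rw [Finset.sum_comm]
  rw [Finset.sum_mul]
  exact Finset.sum_congr rfl fun c _ => by rw [Finset.sum_mul]

variable [DecidableEq (HiggsLattice.PBond P 0)]

/-- The evaluator on `g321Y` with `kind36`-typed index assignments — FILE 1's `amp` unfolded. [cite: Balaban1983Higgs3, p.420] -/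
theorem graphAmp_eqY (M : Model P N k) (dm2 : Fin (g321Y nbar hn).nV → HiggsLattice.Site P 0 → ℝ)
    (loc : Fin (g321Y nbar hn).nV → Loc P k) (Po : OutPairing (g321Y nbar hn))
    (Ks : SLine (g321Y nbar hn) → HiggsLattice.Site P 0 × Fin N → HiggsLattice.Site P 0 × Fin N → ℝ)
    (Kv : VLine (g321Y nbar hn) → HiggsLattice.PBond P 0 → HiggsLattice.PBond P 0 → ℝ)
    (Ko : Po.Line oRank → HiggsLattice.Site P k × Fin N → HiggsLattice.Site P k × Fin N → ℝ)
    (Φ : (ExtSLeg (g321Y nbar hn) → HiggsLattice.Site P 0 × Fin N) → ℝ) (A : (ExtVLeg (g321Y nbar hn) → HiggsLattice.PBond P 0) → ℝ)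
    (Ψ : (Po.Ext → HiggsLattice.Site P k × Fin N) → ℝ) :
    graphAmp (g321Y nbar hn) M dm2 loc Po Ks Kv Ko Φ A Ψ =
      ∑ α : SLeg kind36 → HiggsLattice.Site P 0 × Fin N, ∑ β : VLeg kind36 → HiggsLattice.PBond P 0,
        ∑ ο : OLeg kind36 → HiggsLattice.Site P k × Fin N,
          vertexFactor (rulesOf (g321Y nbar hn) M dm2 loc) basisE basisV basisE α β ο *
            (Φ (fun ℓ => α ℓ.1) * A (fun ℓ => β ℓ.1) * Ψ (fun ℓ => ο ℓ.1)) *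
            (sLineFactor Ks α * vLineFactor Kv β * oLineFactor Po Ko ο) := rfl

/-- **The evaluator EVALUATED on `g321Y`** (two vertices (1.8)_{1,0} at `b ∋ x`, `b′ ∋ x′`; the A′-line `Kv(b,b′)`; at `x` the φ′-LOOP
through the differentiated leg — the line kernel differentiated at its lower end and closed on the vertex's own undifferentiated leg,
`Σ_c dK1(Ks)(b, qe_c; (b₋,c))`; at `x′` both legs external, the differentiated one with its free index `p′`): for ANY joint external
field `Φ`, `E = A(∅)Ψ(∅) · e² Σ_{b,b′∈S} w₀w₁ η^{2d} g_kg_k Kv(b,b′) (Σ_c dK1(Ks)(b, qe_c; (b₋,c))) Σ_{p′,c′} [(D^η_B̃δ_{p′})(b′)·qe_{c′}]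
Φ((b′₋,c′), p′)`. [cite: Balaban1983Higgs3, (3.21) p.438] [cite: Balaban1983Higgs3, (1.8) p.413] [cite: Balaban1983Higgs3, p.414] -/
theorem graphAmp_g321Y (M : Model P N k) (dm2 : Fin (g321Y nbar hn).nV → HiggsLattice.Site P 0 → ℝ)
    (loc : Fin (g321Y nbar hn).nV → Loc P k) (Po : OutPairing (g321Y nbar hn))
    (Ks : SLine (g321Y nbar hn) → HiggsLattice.Site P 0 × Fin N → HiggsLattice.Site P 0 × Fin N → ℝ)
    (Kv : VLine (g321Y nbar hn) → HiggsLattice.PBond P 0 → HiggsLattice.PBond P 0 → ℝ)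
    (Ko : Po.Line oRank → HiggsLattice.Site P k × Fin N → HiggsLattice.Site P k × Fin N → ℝ)
    (Φ : (ExtSLeg (g321Y nbar hn) → HiggsLattice.Site P 0 × Fin N) → ℝ) (A : (ExtVLeg (g321Y nbar hn) → HiggsLattice.PBond P 0) → ℝ)
    (Ψ : (Po.Ext → HiggsLattice.Site P k × Fin N) → ℝ) :
    graphAmp (g321Y nbar hn) M dm2 loc Po Ks Kv Ko Φ A Ψ =
      (A (fun ℓ => isEmptyElim ℓ) * Ψ (fun ℓ => isEmptyElim ℓ)) *
        (M.C.e ^ 2 * ∑ b ∈ M.S, ∑ b' ∈ M.S, (loc (vxY nbar hn 0)).wB b * (loc (vxY nbar hn 1)).wB b' *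
          ((P.mesh 0 ^ P.d) ^ 2 * (M.g b.src * M.g b'.src) * Kv (vlineY nbar hn) b b' *
            ((∑ c : Fin N, dK1 M.C M.B (Ks (slineY nbar hn)) b (M.C.q (EuclideanSpace.single c (1 : ℝ))) (b.src, c)) *
              ∑ p' : HiggsLattice.Site P 0 × Fin N, ∑ c' : Fin N, dq M.C M.B p' b' c' * Φ (yExt (b'.src, c') p')))) := by
  haveI : IsEmpty (Po.Line oRank) := ⟨fun l => IsEmpty.false l.1⟩
  haveI : IsEmpty Po.Ext := ⟨fun l => IsEmpty.false l.1⟩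
  have hV : ∀ (α : SLeg kind36 → HiggsLattice.Site P 0 × Fin N) (β : VLeg kind36 → HiggsLattice.PBond P 0)
      (ο : OLeg kind36 → HiggsLattice.Site P k × Fin N),
      vertexFactor (rulesOf (g321Y nbar hn) M dm2 loc) basisE basisV basisE α β ο =
        rule18 M.C M.g M.B M.At 1 0 M.S (loc (vxY nbar hn 0)).wB (fun j => basisE (α (ta 0 j))) (fun j => basisV (β ⟨0, j⟩)) *
          rule18 M.C M.g M.B M.At 1 0 M.S (loc (vxY nbar hn 1)).wB (fun j => basisE (α (ta 1 j))) (fun j => basisV (β ⟨1, j⟩)) := by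
    intro α β ο
    unfold vertexFactor
    exact Fin.prod_univ_two _
  have hs : ∀ α : SLeg kind36 → HiggsLattice.Site P 0 × Fin N, sLineFactor Ks α = Ks (slineY nbar hn) (α (ta 0 0)) (α (ta 0 1)) := by
    intro α
    unfold sLineFactor
    rw [Fintype.prod_unique]
    show Ks (slineY nbar hn) (α (ta 0 0)) (α ((sPairing (g321Y nbar hn)).mate (ta 0 0))) = _
    rw [mateY.1]
  have hv : ∀ β : VLeg kind36 → HiggsLattice.PBond P 0, vLineFactor Kv β = Kv (vlineY nbar hn) (β (tv 0)) (β (tv 1)) := by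
    intro β
    unfold vLineFactor
    rw [Fintype.prod_unique]
    show Kv (vlineY nbar hn) (β (tv 0)) (β ((vPairing (g321Y nbar hn)).mate (tv 0))) = _
    rw [mateY.2]
  have ho : ∀ ο : OLeg kind36 → HiggsLattice.Site P k × Fin N, oLineFactor Po Ko ο = 1 := by
    intro ο
    unfold oLineFactor
    exact Fintype.prod_empty _
  have hA : ∀ β : VLeg kind36 → HiggsLattice.PBond P 0, (fun ℓ : ExtVLeg (g321Y nbar hn) => β ℓ.1) = fun ℓ => isEmptyElim ℓ :=
    fun β => funext fun ℓ => isEmptyElim ℓ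
  have hΨ : ∀ ο : OLeg kind36 → HiggsLattice.Site P k × Fin N, (fun ℓ : Po.Ext => ο ℓ.1) = fun ℓ => isEmptyElim ℓ :=
    fun ο => funext fun ℓ => isEmptyElim ℓ
  rw [graphAmp_eqY]
  simp only [Fintype.sum_unique, hV, hs, hv, ho, hA, hΨ, mul_one, rule18_basis, ext_fun_eqY]
  -- bond sums outermost
  have h := rearrange2 M.S M.C.e
    (fun b (α : SLeg kind36 → HiggsLattice.Site P 0 × Fin N) (β : VLeg kind36 → HiggsLattice.PBond P 0) =>
      vterm M (loc (vxY nbar hn 0)).wB b (α (ta 0 0)) (α (ta 0 1)) (β (tv 0)))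
    (fun b (α : SLeg kind36 → HiggsLattice.Site P 0 × Fin N) (β : VLeg kind36 → HiggsLattice.PBond P 0) =>
      vterm M (loc (vxY nbar hn 1)).wB b (α (ta 1 0)) (α (ta 1 1)) (β (tv 1)))
    (fun α _ => Φ (yExt (α (ta 1 1)) (α (ta 1 0))) * A (fun ℓ => isEmptyElim ℓ) * Ψ (fun ℓ => isEmptyElim ℓ))
    (fun α β => Ks (slineY nbar hn) (α (ta 0 0)) (α (ta 0 1)) * Kv (vlineY nbar hn) (β (tv 0)) (β (tv 1)))
  beta_reduce at h
  rw [h, mul_left_comm _ (M.C.e ^ 2) _]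
  congr 1
  rw [Finset.mul_sum]
  refine Finset.sum_congr rfl fun b _ => ?_
  rw [Finset.mul_sum]
  refine Finset.sum_congr rfl fun b' _ => ?_
  -- the summand with the two bond deltas in front
  have h2 : ∀ (α : SLeg kind36 → HiggsLattice.Site P 0 × Fin N) (β : VLeg kind36 → HiggsLattice.PBond P 0),
      vterm M (loc (vxY nbar hn 0)).wB b (α (ta 0 0)) (α (ta 0 1)) (β (tv 0)) *
          (vterm M (loc (vxY nbar hn 1)).wB b' (α (ta 1 0)) (α (ta 1 1)) (β (tv 1)) *
            (Φ (yExt (α (ta 1 1)) (α (ta 1 0))) * A (fun ℓ => isEmptyElim ℓ) * Ψ (fun ℓ => isEmptyElim ℓ) *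
              (Ks (slineY nbar hn) (α (ta 0 0)) (α (ta 0 1)) * Kv (vlineY nbar hn) (β (tv 0)) (β (tv 1))))) =
        (if b = β (tv 0) then (1 : ℝ) else 0) * ((if b' = β (tv 1) then (1 : ℝ) else 0) *
          (Kv (vlineY nbar hn) (β (tv 0)) (β (tv 1)) * ((A (fun ℓ => isEmptyElim ℓ) * Ψ (fun ℓ => isEmptyElim ℓ)) *
            ((loc (vxY nbar hn 0)).wB b * (P.mesh 0 ^ P.d * M.g b.src) * ((loc (vxY nbar hn 1)).wB b' * (P.mesh 0 ^ P.d * M.g b'.src))) *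
            ((if b.src = (α (ta 0 1)).1 then (1 : ℝ) else 0) * ((if b'.src = (α (ta 1 1)).1 then (1 : ℝ) else 0) *
              (dq M.C M.B (α (ta 0 0)) b (α (ta 0 1)).2 * dq M.C M.B (α (ta 1 0)) b' (α (ta 1 1)).2 *
                Ks (slineY nbar hn) (α (ta 0 0)) (α (ta 0 1)) * Φ (yExt (α (ta 1 1)) (α (ta 1 0))))))))) := by
    intro α β
    unfold vterm
    ring
  rw [Finset.sum_congr rfl fun α _ => Finset.sum_congr rfl fun β _ => h2 α β]
  -- the A′-leg sum
  have h3 : ∀ α : SLeg kind36 → HiggsLattice.Site P 0 × Fin N,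
      ∑ β : VLeg kind36 → HiggsLattice.PBond P 0, (if b = β (tv 0) then (1 : ℝ) else 0) * ((if b' = β (tv 1) then (1 : ℝ) else 0) *
          (Kv (vlineY nbar hn) (β (tv 0)) (β (tv 1)) * ((A (fun ℓ => isEmptyElim ℓ) * Ψ (fun ℓ => isEmptyElim ℓ)) *
            ((loc (vxY nbar hn 0)).wB b * (P.mesh 0 ^ P.d * M.g b.src) * ((loc (vxY nbar hn 1)).wB b' * (P.mesh 0 ^ P.d * M.g b'.src))) *
            ((if b.src = (α (ta 0 1)).1 then (1 : ℝ) else 0) * ((if b'.src = (α (ta 1 1)).1 then (1 : ℝ) else 0) *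
              (dq M.C M.B (α (ta 0 0)) b (α (ta 0 1)).2 * dq M.C M.B (α (ta 1 0)) b' (α (ta 1 1)).2 *
                Ks (slineY nbar hn) (α (ta 0 0)) (α (ta 0 1)) * Φ (yExt (α (ta 1 1)) (α (ta 1 0))))))))) =
        Kv (vlineY nbar hn) b b' * ((A (fun ℓ => isEmptyElim ℓ) * Ψ (fun ℓ => isEmptyElim ℓ)) *
            ((loc (vxY nbar hn 0)).wB b * (P.mesh 0 ^ P.d * M.g b.src) * ((loc (vxY nbar hn 1)).wB b' * (P.mesh 0 ^ P.d * M.g b'.src))) *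
            ((if b.src = (α (ta 0 1)).1 then (1 : ℝ) else 0) * ((if b'.src = (α (ta 1 1)).1 then (1 : ℝ) else 0) *
              (dq M.C M.B (α (ta 0 0)) b (α (ta 0 1)).2 * dq M.C M.B (α (ta 1 0)) b' (α (ta 1 1)).2 *
                Ks (slineY nbar hn) (α (ta 0 0)) (α (ta 0 1)) * Φ (yExt (α (ta 1 1)) (α (ta 1 0))))))) := by
    intro α
    rw [beta_sum2]
    rw [(bAssign_apply b b').1, (bAssign_apply b b').2]
  rw [Finset.sum_congr rfl fun α _ => h3 α, ← Finset.mul_sum, ← Finset.mul_sum]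
  -- the φ′-leg sum
  have h4 := alpha_sum2' (N := N) b.src b'.src fun p p' r r' =>
    dq M.C M.B p b r.2 * dq M.C M.B p' b' r'.2 * Ks (slineY nbar hn) p r * Φ (yExt r' p')
  beta_reduce at h4
  rw [h4]
  -- the loop and the external legs factor
  have h5a : ∀ (p p' : HiggsLattice.Site P 0 × Fin N) (c c' : Fin N),
      dq M.C M.B p b (b.src, c).2 * dq M.C M.B p' b' (b'.src, c').2 * Ks (slineY nbar hn) p (b.src, c) * Φ (yExt (b'.src, c') p') =
      (Ks (slineY nbar hn) p (b.src, c) * dq M.C M.B p b c) * (dq M.C M.B p' b' c' * Φ (yExt (b'.src, c') p')) := by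
    intro p p' c c'
    ring
  simp only [h5a]
  rw [sum4_factor (fun p c => Ks (slineY nbar hn) p (b.src, c) * dq M.C M.B p b c) (fun p' c' => dq M.C M.B p' b' c' * Φ (yExt (b'.src, c') p'))]
  simp only [← dK1_single]
  ring

/-- **`g321Y` for a product external field** (`φ` in the undifferentiated leg, `φ′` in the differentiated leg of vertex 1): `Σ_{p′} φ′(p′)
[(D^η_B̃δ_{p′})(b′)·qe_{c′}] = (D^η_B̃φ′)(b′)·qe_{c′}`, `Σ_{c′}(…)φ(b′₋)_{c′} = (D^η_B̃φ′)(b′)·qφ(b′₋)`: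
`E = A(∅)Ψ(∅) · e² Σ_{b,b′∈S} w₀w₁ η^{2d} g_kg_k Kv(b,b′) (Σ_c dK1(Ks)(b, qe_c; (b₋,c))) [(D^η_B̃φ′)(b′)·qφ(b′₋)]`.
[cite: Balaban1983Higgs3, (3.21) p.438] [cite: Balaban1983Higgs3, (1.8) p.413] -/
theorem graphAmp_g321Y_extS (M : Model P N k) (dm2 : Fin (g321Y nbar hn).nV → HiggsLattice.Site P 0 → ℝ)
    (loc : Fin (g321Y nbar hn).nV → Loc P k) (Po : OutPairing (g321Y nbar hn))
    (Ks : SLine (g321Y nbar hn) → HiggsLattice.Site P 0 × Fin N → HiggsLattice.Site P 0 × Fin N → ℝ)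
    (Kv : VLine (g321Y nbar hn) → HiggsLattice.PBond P 0 → HiggsLattice.PBond P 0 → ℝ)
    (Ko : Po.Line oRank → HiggsLattice.Site P k × Fin N → HiggsLattice.Site P k × Fin N → ℝ)
    (φs : ExtSLeg (g321Y nbar hn) → HiggsLattice.ScalarField P 0 N) (A : (ExtVLeg (g321Y nbar hn) → HiggsLattice.PBond P 0) → ℝ)
    (Ψ : (Po.Ext → HiggsLattice.Site P k × Fin N) → ℝ) :
    graphAmp (g321Y nbar hn) M dm2 loc Po Ks Kv Ko (extS (g321Y nbar hn) φs) A Ψ =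
      (A (fun ℓ => isEmptyElim ℓ) * Ψ (fun ℓ => isEmptyElim ℓ)) *
        (M.C.e ^ 2 * ∑ b ∈ M.S, ∑ b' ∈ M.S, (loc (vxY nbar hn 0)).wB b * (loc (vxY nbar hn 1)).wB b' *
          ((P.mesh 0 ^ P.d) ^ 2 * (M.g b.src * M.g b'.src) * Kv (vlineY nbar hn) b b' *
            ((∑ c : Fin N, dK1 M.C M.B (Ks (slineY nbar hn)) b (M.C.q (EuclideanSpace.single c (1 : ℝ))) (b.src, c)) *
              ⟪covDeriv M.C M.B (φs (esY nbar hn 1)) b', M.C.q (φs (esY nbar hn 0) b'.src)⟫_ℝ))) := by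
  rw [graphAmp_g321Y]
  simp only [extS_yExt]
  have h : ∀ b' : HiggsLattice.PBond P 0,
      ∑ p' : HiggsLattice.Site P 0 × Fin N, ∑ c' : Fin N, dq M.C M.B p' b' c' * (φs (esY nbar hn 0) (b'.src, c').1 (b'.src, c').2 * φs (esY nbar hn 1) p'.1 p'.2) =
      ⟪covDeriv M.C M.B (φs (esY nbar hn 1)) b', M.C.q (φs (esY nbar hn 0) b'.src)⟫_ℝ := by
    intro b'
    rw [Finset.sum_comm]
    have h1 : ∀ c' : Fin N, ∑ p' : HiggsLattice.Site P 0 × Fin N, dq M.C M.B p' b' c' *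
        (φs (esY nbar hn 0) (b'.src, c').1 (b'.src, c').2 * φs (esY nbar hn 1) p'.1 p'.2) =
        ⟪covDeriv M.C M.B (φs (esY nbar hn 1)) b', M.C.q (EuclideanSpace.single c' (1 : ℝ))⟫_ℝ * φs (esY nbar hn 0) b'.src c' := by
      intro c'
      rw [← sum_coord_covDeriv_basisE M.C M.B (φs (esY nbar hn 1)) b', Finset.sum_mul]
      unfold dq
      exact Finset.sum_congr rfl fun p' _ => by ring
    simp only [h1]
    exact sum_inner_T_single M.C.q _ _
  simp only [h]

/-- **AT ZERO BACKGROUND WITH THE FREE SCALAR KERNEL `g321Y` VANISHES**: the φ′-loop closed on its own vertex gives `(∂^η_μG₀)(x,x)·Σ_c e_c·qe_c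
= (∂^η_μG₀)(x,x)·tr q = 0` (`q` antisymmetric) — for every choice of the other data (vector kernel, weights, bond set, external field);
consistent with print drawing only two graphs in (3.21) (p18: *"its closed scalar loop carries one power of q"*).
[cite: Balaban1983Higgs3, (3.21) p.438] [cite: Balaban1982Higgs1, (1.7) p.605] -/
theorem graphAmp_g321Y_free (M : Model P N k) (hB : M.B = 0)
    (dm2 : Fin (g321Y nbar hn).nV → HiggsLattice.Site P 0 → ℝ) (loc : Fin (g321Y nbar hn).nV → Loc P k)
    (Po : OutPairing (g321Y nbar hn)) (Ks : SLine (g321Y nbar hn) → HiggsLattice.Site P 0 × Fin N → HiggsLattice.Site P 0 × Fin N → ℝ)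
    (Kv : VLine (g321Y nbar hn) → HiggsLattice.PBond P 0 → HiggsLattice.PBond P 0 → ℝ)
    (Ko : Po.Line oRank → HiggsLattice.Site P k × Fin N → HiggsLattice.Site P k × Fin N → ℝ)
    (G0 : HiggsLattice.Site P 0 → HiggsLattice.Site P 0 → ℝ)
    (hKs : ∀ p p', Ks (slineY nbar hn) p p' = if p.2 = p'.2 then G0 p.1 p'.1 else 0)
    (Φ : (ExtSLeg (g321Y nbar hn) → HiggsLattice.Site P 0 × Fin N) → ℝ) (A : (ExtVLeg (g321Y nbar hn) → HiggsLattice.PBond P 0) → ℝ)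
    (Ψ : (Po.Ext → HiggsLattice.Site P k × Fin N) → ℝ) :
    graphAmp (g321Y nbar hn) M dm2 loc Po Ks Kv Ko Φ A Ψ = 0 := by
  rw [graphAmp_g321Y]
  have hK : Ks (slineY nbar hn) = fun p p' => if p.2 = p'.2 then G0 p.1 p'.1 else 0 := funext fun p => funext fun p' => hKs p p'
  have h0 : ∀ b : HiggsLattice.PBond P 0,
      ∑ c : Fin N, dK1 M.C M.B (Ks (slineY nbar hn)) b (M.C.q (EuclideanSpace.single c (1 : ℝ))) (b.src, c) = 0 := by
    rintro ⟨x, μ⟩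
    rw [hK, hB]
    simp only [dK1_zero_free]
    rw [← Finset.mul_sum, sum_q_single_diag, mul_zero]
  simp only [h0, zero_mul, mul_zero, Finset.sum_const_zero]

end EvalY

end

end Literature.MathematicalPhysics.QuantumFieldTheory.Balaban1983to89.B3Eq322FromFeynmanRules
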